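import Literature.AlgebraicGeometry.HodgeTheory.RankOneCentreTimesCMCurveProductSpan
import Literature.AlgebraicGeometry.Motives.HodgeThetaAnnihilatorCentreTimesRankOneTorus
import Literature.AlgebraicGeometry.HodgeTheory.EllipticCurvesProductsHodgeClassesOfRiemann
import Literature.AlgebraicGeometry.HodgeTheory.AbelianVarietyHodgeFullnessHolds
import HarnessLib

/-!
# `A × E`, `A` arbitrary, `E` a CM elliptic curve, under the trace non-resonance: invariance, product span, condition (D), and the row `E_k × E_{k'} × T` of Moonen–Zarhin's Thm. 0.2 (4) («no embedding of `k` into the centre `k' × k''` of `End⁰(E_{k'} × T)`»; Moonen–Zarhin 1999 (3.1), Prop. (3.8), §5 (5.11))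

Family `hodge`, layer `Literature/AlgebraicGeometry/HodgeTheory`. Research context: cell `pub-hodge-ring2` (HONEST
FRAMING: research route conditional on HC_CM; not a corollary; Q11.4-sentence-2 already refuted in dim ≥ 3),
Literature lane, programme R28 — geometric half, the sequel of the abstract Lie step
`Motives/HodgeThetaAnnihilatorCentreTimesRankOneTorus` (Moonen–Zarhin Prop. (3.8) for a first factor with ARBITRARY
centre) and of the rank-one files `RankOneCentreTimesCMCurveInvariance` / `RankOneCentreTimesCMCurveProductSpan` (R24).
UNCONDITIONAL (no HC_CM); theorems only (no definition, no named fact, D-0026; nothing admitted); no step towards a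
summit statement beyond the printed results it formalizes.

PRINTED RESULTS. B. Moonen, Yu. Zarhin, *Hodge classes on abelian varieties of low dimension*, Math. Ann. 315 (1999)
[held: `paper:arxiv-math_9901113`, locators = held TeX chunks]: Prop. (3.8) (chunk p0007) «Let `X` be an abelian
variety and let `E` be an elliptic curve, both over `ℂ`. Suppose `Hom(E,X) = 0`. Then either `Hg(X × E) = Hg(X) × Hg(E)`
or `End⁰(E) = k` is an imaginary quadratic field such that there exists an embedding of `k` into the center of
`End⁰(X)`»; §3 (3.1) and Thm. (3.2) (chunk p0006); Thm. 0.2 (4) (chunks p0001–p0002) «if `X` has no simple factor of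
dimension 4 then `B•(Xⁿ) = D•(Xⁿ)` for every `n ≥ 1`» with cases (e) «`X` is isogenous to `X₁ × X₂ × X₃`, where `X₁`
and `X₂` are as in (a) and `X₃` is an elliptic curve such that `X₁` and `X₃` are not isogenous» and (f); §5 (5.11)
(chunk p0010) «If `d_max = 3` then `Y` is isogenous to a product of an elliptic curve `Y₁` and a simple abelian
threefold `Y₂`. If `End⁰(Y₂)` contains an imaginary quadratic field then this subfield is unique. Therefore, possibly
after interchanging the roles of `E` and `Y₁` we find that there does not exist an embedding of `End⁰(E)` into the
center of `End⁰(Y)`. (Note that `End⁰(E) = End⁰(Y₁)` implies that `E ∼ Y₁`, which we excluded.) Again by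
Proposition (3.8) we then find `Hg(X) = Hg(E) × Hg(Y)`»; §2 (2.3) (chunk p0005) type IV(1,1).

THIS FILE. §1 two real lemmas: `√a·√b ∉ ℚ` when `a ≠ q²b` for all rational `q` (`sqrt_mul_sqrt_ne_ratCast_of_forall_ne`),
and **`sqrt_ne_ratCast_mul_sqrt_add_of_forall_ne`**: `√d' ≠ q₁√d₁ + q₂√d₂` for all rational `q₁, q₂` as soon as
`d' ≠ q²d₁` and `d' ≠ q²d₂` for all rational `q` (an embedding of `k = ℚ(√-d')` into `k₁ × k₂` is an embedding into
`k₁` or into `k₂`). §2 `trace_hodgeTheta_eq_zero_of_weight_one`: `tr Θ = h^{1,0} - h^{0,1} = 0` in effective weight one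
(Hodge symmetry, the tree's `exists_hodgeAdapted_pairBasis`). §3 **`AVSlots.exists_coeff_eq_zero_off_balanced_of_prod_centre_cmCurve`** — the
INVARIANCE THEOREM for slots over `A × E`: `A` ANY complex abelian variety, `dim E = 1`, `χ ≫ χ = -d'`, and the trace
non-resonance (NONRES): for the Hodge grading operators `Θ_A`, `Θ_E` and every central Hodge endomorphism `b` of
`H¹(A(ℂ); ℚ)`, `tr((χ^*)²)·tr(Θ_A ∘ b_ℂ) ≠ tr(Θ_E ∘ χ^*_ℂ)` ⟹ every rational `(p,p)`-class on `X` with slots over `A × E` has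
a letter expansion vanishing off the `A`-kind-balanced words (the tree's `RankOneCentreTimesCMCurveInvariance` §3 verbatim
with the Lie step `wordDerAt_incl_theta_proj_eq_zero_of_centre_times_cmCurve`). (NONRES) is the Lie shadow of «no embedding
of `k = ℚ(√-d')` into the center of `End⁰(A)`»: `b ↦ tr(Θ_A b)` is the differential of the character by which the centre
of `End_Hdg(H¹(A))` acts on `det H^{1,0}(A)`, and `tr(Θ_E χ^*)/tr((χ^*)²) = ∓ i/√d'` is the slope of `Lie U_k`; for `A` with
`End⁰(A) = ℚ(√-d)` it is R24's `d ≠ q²d'` (`traceSlopes_ne_of_forall_ne_sq_mul`). §4 the PRODUCT SPAN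
`HodgeClassesProductSpan B Z` for slots over `A × E` under (NONRES) — the tree's `RankOneCentreTimesCMCurveProductSpan` §2
verbatim on the new invariance theorem — its equal-powers form, and §5 CONDITION (D): `A` stably nondegenerate ⟹ `A × E`
and `E × A` stably nondegenerate (`IsStablyNondegenerate.prod_cmCurve_of_traceNonres`). §6 **(NONRES) FOR `A = A₁ × A₂`
WITH IMAGINARY QUADRATIC `End⁰(Aᵢ) = ℚ(√-dᵢ)`** (`traceNonres_prod_of_quadraticEnd`): a central Hodge endomorphism `b` of
`H¹(A₁ × A₂)` has corners `bᵢ = xᵢ + yᵢφᵢ^*` (Riemann: `End_Hdg(H¹(Aᵢ)) = ℚ + ℚφᵢ^*`), so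
`tr(Θ_A b) = 2i(y₁m₁√d₁ + y₂m₂√d₂)` (`mᵢ = nᵢ - nᵢ'` the multiplicity differences, `tr Θ_{Aᵢ} = 0`), while
`tr(Θ_E χ^*)/tr((χ^*)²) = ∓ i/√d'`; a resonance would put `√d'` in `ℚ√d₁ + ℚ√d₂` — §1. §7 **THE ROW (5.11)**: for
elliptic curves `E₁, E₂` OF CM TYPE, NOT ISOGENOUS, and a SIMPLE abelian threefold `T` with `dim_ℚ End⁰(T) = 2` (type
IV(1,1), NOT of CM type) admitting NO ring homomorphism `End⁰(Eᵢ) → End⁰(T)`, `E₁ × (E₂ × T)` is stably nondegenerate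
(`isStablyNondegenerate_cmCurve_prod_cmCurve_prod_of_isSimple_threefold_of_finrank_eq_two`: `E₂ × T` is (D) by the
tree's R24 row `isStablyNondegenerate_cmCurve_prod_of_isSimple_threefold_of_finrank_eq_two_of_isEmpty`, then §5–§6 with
`A₁ = E₂`, `A₂ = T`; `k₁ ≇ k₂` from «not isogenous» by the tree's `EllipticCurve.not_isSquare_of_not_hodgeIsogenous` and
Riemann `deligneMilne1982_Thm_6_20_full_holds`), and in the spelling of the cell's master theorem
(`¬ IsOfCMType T ∧ ¬ HasNoTypeIVFactor T`: `dim_ℚ End⁰(T) ∈ {1,2,3,6}` minus `1, 3` (no type IV) and `6` (CM type))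
**`isStablyNondegenerate_cmCurve_prod_cmCurve_prod_threefold_of_typeIV_of_not_isOfCMType`** — the hypothesis `hEET` of
`Summit.HodgeConjecture.Ring2.NonSimpleFivefolds.isStablyNondegenerate_of_dim_eq_five_of_not_isSimple_of`, now a theorem;
with the Hodge conjecture for all powers and everything isogenous. NOT asserted: cases (e)/(f) (`k ↪ End⁰(T)`:
exceptional Weil classes, Thm. 0.2 (1)).

## References

* [MoonenZarhin1999LowDim] B. Moonen, Yu. Zarhin, Math. Ann. 315 (1999), Thm. 0.2 (4) with (e)/(f), §2 (2.3), §3 (3.1),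
  Thm. (3.2), Prop. (3.8), §5 (5.11) (held `paper:arxiv-math_9901113` chunks p0001–p0002, p0005–p0007, p0010). [cite: MoonenZarhin1999LowDim, §3 Prop. (3.8) and §5 (5.11)]
* [Deligne1982HodgeCycles] P. Deligne, LNM 900 (1982), I §3 Prop. 3.4, Prop. 3.6. [cite: Deligne1982HodgeCycles, I §3 Prop. 3.6]
* [Lombardo2016] D. Lombardo, Ann. Inst. Fourier 66 (2016), Lemma 3.4 (p. 1229). [cite: Lombardo2016, Lemma 3.4 (p. 1229)]
* [Gordon1999HodgeAVSurvey] B. B. Gordon, App. B in Lewis' *Survey of the Hodge conjecture* (1999), Thm. 7.5, Def. 7.6. [cite: Gordon1999HodgeAVSurvey, Thm. 7.5 and Def. 7.6]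
* [Gordon1997] B. B. Gordon, arXiv:alg-geom/9709030, 1.13.2, Thm. 6.3 (3). [cite: Gordon1997, 1.13.2]
* [DeligneMilne1982Tannakian] P. Deligne, J. S. Milne, LNM 900 (1982), §6 Thm. 6.20 (Riemann). [cite: DeligneMilne1982Tannakian, §6 Thm. 6.20]
* [MumfordAV1970] D. Mumford, *Abelian Varieties*, §19 Cor. 2 of Thm. 1 (p. 174); §21. [cite: MumfordAV1970, §21]
* [SilvermanAEC2009] J. H. Silverman, GTM 106, III.9 Cor. 9.4. [cite: SilvermanAEC2009, III.9 Cor. 9.4]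
* [vanGeemen1994HodgeAV] B. van Geemen, LNM 1594 (1994), §2.4, Lemma 3.7, §3.6. [cite: vanGeemen1994HodgeAV, Lemma 3.7]
* [VoisinHodgeI2002] C. Voisin, *Hodge Theory I*, §7.1.1. [cite: VoisinHodgeI2002, §7.1.1]
-/

noncomputable section

open scoped TensorProduct
open CategoryTheory Module NumberField

namespace Literature.AlgebraicGeometry.HodgeTheory

open Literature.AlgebraicTopology.SingularHomology
open Literature.AlgebraicGeometry.Motives (IsSmoothProjective AbelianVariety bettiCohomology
  ofRatClassBaseChange ofRatClassBaseChange_tmul HodgeTensorFacts hodgeTensorFacts_holds ComplexPoints)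
open Literature.Barriers.HodgeConjecture
open Literature.AlgebraicGeometry.Motives.HodgeStructure
open Literature.AlgebraicGeometry.Motives.AbelianVariety
open Literature.AlgebraicGeometry.ComplexMultiplication
open Literature.AlgebraicGeometry.Milne1999
open Literature.NumberTheory.ComplexMultiplication
open Literature.RepresentationTheory.GeneralLinear
open Literature.NumberTheory.DiophantineGeometry

/-! ### §1 Square roots: `√a√b ∉ ℚ` and `√d' ∉ ℚ√d₁ + ℚ√d₂` -/

section Sqrt

/-- **`√a·√b` is irrational when `a ≠ q²b` for every rational `q`** (`a, b > 0`): if `√a√b = ρ ∈ ℚ` then `ab = ρ²`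
and `a = (ρ/b)²·b`. («`End⁰(E) = End⁰(Y₁)` implies …»: two imaginary quadratic fields `ℚ(√-a)`, `ℚ(√-b)` coincide
iff `ab` is a square.) [cite: MoonenZarhin1999LowDim, §5 (5.11)] -/
theorem sqrt_mul_sqrt_ne_ratCast_of_forall_ne {a b : ℕ} (hb : 0 < b) (h : ∀ q : ℚ, (a : ℚ) ≠ q ^ 2 * b) (ρ : ℚ) :
    Real.sqrt a * Real.sqrt b ≠ (ρ : ℝ) := by
  intro hρ
  have ha0 : (0 : ℝ) ≤ a := Nat.cast_nonneg a
  have hb0 : (0 : ℝ) ≤ b := Nat.cast_nonneg b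
  have hsq : (a : ℝ) * b = (ρ : ℝ) ^ 2 := by
    rw [← hρ, mul_pow, Real.sq_sqrt ha0, Real.sq_sqrt hb0]
  have hsqQ : (a : ℚ) * b = ρ ^ 2 := by exact_mod_cast hsq
  have hbQ : (b : ℚ) ≠ 0 := by exact_mod_cast hb.ne'
  apply h (ρ / b)
  rw [div_pow, div_mul_eq_mul_div, eq_div_iff (pow_ne_zero 2 hbQ)]
  linear_combination (b : ℚ) * hsqQ

/-- **`√d' ≠ q₁√d₁ + q₂√d₂` for all rational `q₁, q₂`, as soon as `d' ≠ q²d₁` and `d' ≠ q²d₂` for every rational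
`q`** (`d', d₁, d₂ > 0`). If `q₂ = 0` (resp. `q₁ = 0`) then `√d'√d₁ = q₁d₁ ∈ ℚ` (resp. `√d'√d₂ ∈ ℚ`); otherwise
squaring gives `√d₁√d₂ = r ∈ ℚ` and `√d'√d₁ = q₁d₁ + q₂r ∈ ℚ`; each contradicts the previous lemma. This is the
arithmetic of «no embedding of `k = ℚ(√-d')` into the center `k₁ × k₂` of `End⁰(Y)`», `kᵢ = ℚ(√-dᵢ)`: a `ℚ`-linear
resonance between the slopes `√d'` and `√d₁, √d₂` forces `k ≅ k₁` or `k ≅ k₂`. [cite: MoonenZarhin1999LowDim, §3 Prop. (3.8) and §5 (5.11)] -/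
theorem sqrt_ne_ratCast_mul_sqrt_add_of_forall_ne {d' d₁ d₂ : ℕ} (hd₁ : 0 < d₁) (hd₂ : 0 < d₂)
    (h₁ : ∀ q : ℚ, (d' : ℚ) ≠ q ^ 2 * d₁) (h₂ : ∀ q : ℚ, (d' : ℚ) ≠ q ^ 2 * d₂) (q₁ q₂ : ℚ) :
    Real.sqrt d' ≠ (q₁ : ℝ) * Real.sqrt d₁ + (q₂ : ℝ) * Real.sqrt d₂ := by
  intro h
  have h0' : (0 : ℝ) ≤ d' := Nat.cast_nonneg d'
  have h01 : (0 : ℝ) ≤ d₁ := Nat.cast_nonneg d₁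
  have h02 : (0 : ℝ) ≤ d₂ := Nat.cast_nonneg d₂
  have s' : Real.sqrt d' * Real.sqrt d' = d' := Real.mul_self_sqrt h0'
  have s₁ : Real.sqrt d₁ * Real.sqrt d₁ = d₁ := Real.mul_self_sqrt h01
  have s₂ : Real.sqrt d₂ * Real.sqrt d₂ = d₂ := Real.mul_self_sqrt h02
  by_cases hq₂ : q₂ = 0
  · -- `√d'√d₁ = q₁ d₁`
    apply sqrt_mul_sqrt_ne_ratCast_of_forall_ne hd₁ h₁ (q₁ * d₁)
    rw [h, hq₂]
    push_cast
    linear_combination (q₁ : ℝ) * s₁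
  by_cases hq₁ : q₁ = 0
  · -- `√d'√d₂ = q₂ d₂`
    apply sqrt_mul_sqrt_ne_ratCast_of_forall_ne hd₂ h₂ (q₂ * d₂)
    rw [h, hq₁]
    push_cast
    linear_combination (q₂ : ℝ) * s₂
  -- both non-zero: `√d₁√d₂` is rational, then `√d'√d₁` is rational
  have hq : (2 : ℝ) * q₁ * q₂ ≠ 0 := by
    have : (q₁ : ℝ) ≠ 0 := by exact_mod_cast hq₁
    have : (q₂ : ℝ) ≠ 0 := by exact_mod_cast hq₂
    positivity
  set r : ℚ := (d' - q₁ ^ 2 * d₁ - q₂ ^ 2 * d₂) / (2 * q₁ * q₂) with hr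
  have hsq : (d' : ℝ) = (q₁ : ℝ) ^ 2 * d₁ + (q₂ : ℝ) ^ 2 * d₂ + 2 * q₁ * q₂ * (Real.sqrt d₁ * Real.sqrt d₂) := by
    rw [← s', h]
    linear_combination (q₁ : ℝ) ^ 2 * s₁ + (q₂ : ℝ) ^ 2 * s₂
  have h12 : Real.sqrt d₁ * Real.sqrt d₂ = (r : ℝ) := by
    rw [hr]
    push_cast
    field_simp
    linear_combination -hsq
  apply sqrt_mul_sqrt_ne_ratCast_of_forall_ne hd₁ h₁ (q₁ * d₁ + q₂ * r)
  rw [h]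
  push_cast
  rw [← h12]
  linear_combination (q₁ : ℝ) * s₁

/-- `d ≠ q²d'` for all rational `q` is symmetric in `d, d'` (`d, d' > 0`). [folklore] -/
private theorem forall_ne_sq_mul_symm {d d' : ℕ} (hd' : 0 < d') (h : ∀ q : ℚ, (d : ℚ) ≠ q ^ 2 * d') :
    ∀ q : ℚ, (d' : ℚ) ≠ q ^ 2 * d := by
  intro q hq
  have hq0 : q ≠ 0 := by
    rintro rfl
    have : (d' : ℚ) = 0 := by rw [hq]; ring
    exact (Nat.cast_ne_zero.2 hd'.ne') this
  apply h q⁻¹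
  rw [hq]
  field_simp

/-- `¬ IsSquare (d d')` ⟹ `d ≠ q²d'` for all rational `q` (`d' > 0`; `d = q²d'` makes `dd' = (qd')²`). [folklore] -/
private theorem forall_ne_sq_mul_of_not_isSquare {d d' : ℕ} (h : ¬ IsSquare (d * d')) : ∀ q : ℚ, (d : ℚ) ≠ q ^ 2 * d' := by
  intro q hq
  apply h
  have hsqQ : ((d * d' : ℕ) : ℚ) = (q * d') * (q * d') := by push_cast; rw [hq]; ring
  exact Rat.isSquare_natCast_iff.1 ⟨q * d', hsqQ⟩

end Sqrt

/-! ### §2 `tr Θ = 0` in effective weight one -/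

section ThetaTrace

universe u

variable {V : Type u} [AddCommGroup V] [Module ℚ V] [Module.Finite ℚ V]

/-- The two elements of `Fin 2`. [folklore] -/
private theorem fin2_eq_zero_or_one_ps (r : Fin 2) : r = 0 ∨ r = 1 := by
  fin_cases r <;> simp

/-- **`tr Θ = h^{1,0} - h^{0,1} = 0`** for the Hodge grading operator of an effective weight-one `ℚ`-Hodge structure
(Hodge symmetry: a basis in pairs `(c_i^0, c_i^1)` with `Θ c_i^0 = c_i^0`, `Θ c_i^1 = -c_i^1`, the tree's
`exists_hodgeAdapted_pairBasis`). [cite: VoisinHodgeI2002, §7.1.1] [cite: Gordon1997, 1.13.2] -/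
theorem trace_hodgeTheta_eq_zero_of_weight_one {n : ℤ} (H : Motives.HodgeStructure V n) (hn : n = 1)
    (heff : H.IsEffective) {Θ : Module.End ℂ (ℂ ⊗[ℚ] V)}
    (hΘ : ∀ p, ∀ x ∈ H.piece p (n - p), Θ x = ((2 * p - n : ℤ) : ℂ) • x) : LinearMap.trace ℂ _ Θ = 0 := by
  classical
  obtain ⟨h, e, he0, he1⟩ := exists_hodgeAdapted_pairBasis H hn heff
  subst hn
  have hΘe : ∀ i r, Θ (e (i, r)) = (if r = 0 then (1 : ℂ) else -1) • e (i, r) := by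
    intro i r
    rcases fin2_eq_zero_or_one_ps r with rfl | rfl
    · rw [if_pos rfl, hΘ 1 _ (he0 i)]
      norm_num
    · rw [if_neg one_ne_zero, hΘ 0 _ (he1 i)]
      norm_num
  rw [LinearMap.trace_eq_matrix_trace ℂ e, Matrix.trace, Fintype.sum_prod_type]
  refine Finset.sum_eq_zero fun i _ => ?_
  rw [Fin.sum_univ_two, Matrix.diag_apply, Matrix.diag_apply, LinearMap.toMatrix_apply, LinearMap.toMatrix_apply,
    hΘe, hΘe, map_smul, map_smul, e.repr_self, e.repr_self]
  simp

end ThetaTrace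

/-! ### §3 The invariance theorem for slots over `A × E` under (NONRES) -/

section Invariance

variable {A C X : AbelianVariety ℂ} {n : ℕ} {g : Fin n → (X ⟶ A.prod C)}

/-- The two elements of `Fin 2`. [folklore] -/
private theorem fin2_eq_zero_or_one_ct (r : Fin 2) : r = 0 ∨ r = 1 := by
  fin_cases r <;> simp

open scoped Classical in
/-- **The INVARIANCE THEOREM for slots over `A × C`, `A` ARBITRARY, `C` an elliptic curve with complex
multiplication `χ² = -d'`, under the trace non-resonance (NONRES)** (Moonen–Zarhin 1999 Prop. (3.8), Lie step —
«either `Hg(X × E) = Hg(X) × Hg(E)` or `End⁰(E) = k` … embeds into the center of `End⁰(X)`»). Hypothesis (NONRES):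
for the Hodge grading operators `Θ_A`, `Θ_C` and every CENTRAL Hodge endomorphism `b` of `H¹(A(ℂ); ℚ)` (rational,
commuting with `End_Hdg(H¹(A)) = End⁰(A)^{op}`), `tr((χ^*)²)·tr(Θ_A ∘ b_ℂ) ≠ tr(Θ_C ∘ χ^*_ℂ)` (the Lie shadow of «no
embedding of `k` into the center of `End⁰(X)`»; for `A = A₁ × A₂` with imaginary quadratic `End⁰(Aᵢ)` it is
`√d' ∉ ℚ√d₁ + ℚ√d₂`, §6). Conclusion = the tree's
`AVSlots.exists_coeff_eq_zero_off_balanced_of_prod_quadraticEnd_cmCurve` (the rank-one case `End⁰(A) = ℚ(φ)`):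
there are Hodge-adapted pair bases of `H¹(A) ⊗ ℂ` and `H¹(C) ⊗ ℂ` such that every rational `(p,p)`-class on `X` (slots
`g` over `A × C`) has a letter expansion whose coefficient function VANISHES off the `A`-kind-balanced words — the
tensor invariants of `X` are invariants of `Θ_A ⊕ 0`. Proof = the tree's proof verbatim, the Lie step now
`wordDerAt_incl_theta_proj_eq_zero_of_centre_times_cmCurve`. [cite: MoonenZarhin1999LowDim, §3 Prop. (3.8)]
[cite: MoonenZarhin1999LowDim, §3 (3.1) and Lemma (3.6)] [cite: Deligne1982HodgeCycles, I §3 Prop. 3.4 and Prop. 3.6]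
[cite: Lombardo2016, Lemma 3.4 (p. 1229)] -/
theorem AVSlots.exists_coeff_eq_zero_off_balanced_of_prod_centre_cmCurve (hg : AVSlots (A.prod C) X g)
    (hC1 : C.dim = 1) (χ : C ⟶ C) {d' : ℕ} (hd' : 0 < d') (hχ : χ ≫ χ = -(d' • 𝟙 C))
    (hNR : ∀ {ΘA : Module.End ℂ (ℂ ⊗[ℚ] bettiCohomology A.X 1)},
      (∀ p, ∀ x ∈ (BettiUniverse.hodge exists_isReal_hodgeModel_holds
        (AbelianVariety.isSmoothProjective_holds (A := A)) 1).piece p (((1 : ℕ) : ℤ) - p),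
        ΘA x = ((2 * p - ((1 : ℕ) : ℤ) : ℤ) : ℂ) • x) →
      ∀ {ΘC : Module.End ℂ (ℂ ⊗[ℚ] bettiCohomology C.X 1)},
      (∀ p, ∀ x ∈ (BettiUniverse.hodge exists_isReal_hodgeModel_holds
        (AbelianVariety.isSmoothProjective_holds (A := C)) 1).piece p (((1 : ℕ) : ℤ) - p),
        ΘC x = ((2 * p - ((1 : ℕ) : ℤ) : ℤ) : ℂ) • x) →
      ∀ b ∈ (BettiUniverse.hodge exists_isReal_hodgeModel_holds
        (AbelianVariety.isSmoothProjective_holds (A := A)) 1).endAlg,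
      (∀ a ∈ (BettiUniverse.hodge exists_isReal_hodgeModel_holds
        (AbelianVariety.isSmoothProjective_holds (A := A)) 1).endAlg, b * a = a * b) →
      ((LinearMap.trace ℚ _ ((bettiCohomology.map χ.hom.hom.hom 1).hom *
          (bettiCohomology.map χ.hom.hom.hom 1).hom) : ℚ) : ℂ) * LinearMap.trace ℂ _ (ΘA * b.baseChange ℂ) ≠
        LinearMap.trace ℂ _ (ΘC * (bettiCohomology.map χ.hom.hom.hom 1).hom.baseChange ℂ)) :
    ∃ (hA : ℕ) (bA : Module.Basis (Fin hA × Fin 2) ℂ (ℂ ⊗[ℚ] bettiCohomology A.X 1))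
      (h : ℕ) (cC : Module.Basis (Fin h × Fin 2) ℂ (ℂ ⊗[ℚ] bettiCohomology C.X 1)),
      (∀ i, IsOfHodgeType A.dim A.X 1 1 0 (ofRatClassBaseChange (Motives.ComplexPoints A.X) 1 (bA (i, 0)))) ∧
      (∀ i, IsOfHodgeType A.dim A.X 1 0 1 (ofRatClassBaseChange (Motives.ComplexPoints A.X) 1 (bA (i, 1)))) ∧
      (∀ i, IsOfHodgeType C.dim C.X 1 1 0 (ofRatClassBaseChange (Motives.ComplexPoints C.X) 1 (cC (i, 0)))) ∧
      (∀ i, IsOfHodgeType C.dim C.X 1 0 1 (ofRatClassBaseChange (Motives.ComplexPoints C.X) 1 (cC (i, 1)))) ∧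
      ∀ {p : ℕ}, 0 < p → ∀ {c : complexBetti X.X (2 * p)}, IsRationalClass c →
        IsOfHodgeType X.dim X.X (2 * p) p p c →
        ∃ a : (Fin (2 * p) → (Fin n × (Fin hA ⊕ Fin h)) × Fin 2) → ℂ,
          wordEval (cupPowOneAlt ℂ (Motives.ComplexPoints X.X) (2 * p))
            (fun jr : (Fin n × (Fin hA ⊕ Fin h)) × Fin 2 => complexBetti.map (g jr.1.1).hom.hom.hom 1
              (Sum.elim
                (fun i => complexBetti.map (Motives.AbelianVariety.fst A C).hom.hom.hom 1
                  (ofRatClassBaseChange (Motives.ComplexPoints A.X) 1 (bA (i, jr.2))))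
                (fun i => complexBetti.map (Motives.AbelianVariety.snd A C).hom.hom.hom 1
                  (ofRatClassBaseChange (Motives.ComplexPoints C.X) 1 (cC (i, jr.2))))
                jr.1.2)) a = c ∧
          ∀ (U : Fin (2 * p) → Fin n × (Fin hA ⊕ Fin h)) (η : Fin (2 * p) → Fin 2),
            (∑ t, Sum.elim (fun _ : Fin hA => if η t = 0 then (1 : ℂ) else -1) (fun _ : Fin h => (0 : ℂ)) (U t).2) ≠ 0 →
            a (fun t => (U t, η t)) = 0 := by
  classical
  -- the setting
  have hHD : exists_isReal_hodgeModel := exists_isReal_hodgeModel_holds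
  have hI : hodgePQ_independent_of_hodgeModel := hodgePQ_independent_of_hodgeModel_holds
  haveI : HodgeTensorFacts.{0, 0} := hodgeTensorFacts_holds.{0, 0}
  have hXA : IsSmoothProjective A.dim A.X := AbelianVariety.isSmoothProjective_holds
  have hXC : IsSmoothProjective C.dim C.X := AbelianVariety.isSmoothProjective_holds
  have hXP : IsSmoothProjective (A.prod C).dim (A.prod C).X := AbelianVariety.isSmoothProjective_holds
  haveI : Module.Finite ℚ (bettiCohomology A.X 1) := finite_bettiCohomology_one A
  haveI : Module.Finite ℚ (bettiCohomology C.X 1) := finite_bettiCohomology_one C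
  haveI : Module.Finite ℚ (bettiCohomology (A.prod C).X 1) := finite_bettiCohomology_one (A.prod C)
  have hn1 : (((1 : ℕ) : ℤ)) = 1 := by norm_num
  -- the pair bases of `H¹(A) ⊗ ℂ` and `H¹(C) ⊗ ℂ`
  obtain ⟨hA, bA, hbA0, hbA1⟩ := exists_hodgeAdapted_pairBasis (BettiUniverse.hodge hHD hXA 1) (by norm_num)
    (BettiUniverse.hodge_isEffective hHD hXA 1)
  have hbA0' : ∀ i, bA (i, 0) ∈ (BettiUniverse.hodge hHD hXA 1).piece 1 0 := fun i => by simpa using hbA0 i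
  have hbA1' : ∀ i, bA (i, 1) ∈ (BettiUniverse.hodge hHD hXA 1).piece 0 1 := fun i => by simpa using hbA1 i
  obtain ⟨h, cC, hcC0, hcC1⟩ := exists_hodgeAdapted_pairBasis (BettiUniverse.hodge hHD hXC 1) (by norm_num)
    (BettiUniverse.hodge_isEffective hHD hXC 1)
  have hcC0' : ∀ i, cC (i, 0) ∈ (BettiUniverse.hodge hHD hXC 1).piece 1 0 := fun i => by simpa using hcC0 i
  have hcC1' : ∀ i, cC (i, 1) ∈ (BettiUniverse.hodge hHD hXC 1).piece 0 1 := fun i => by simpa using hcC1 i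
  refine ⟨hA, bA, h, cC, fun i => ?_, fun i => ?_, fun i => ?_, fun i => ?_, ?_⟩
  · exact (BettiUniverse.mem_hodge_piece_iff hHD hI hXA (k := 1) (p := 1) (q := 0) rfl _).1 (hbA0' i)
  · exact (BettiUniverse.mem_hodge_piece_iff hHD hI hXA (k := 1) (p := 0) (q := 1) rfl _).1 (hbA1' i)
  · exact (BettiUniverse.mem_hodge_piece_iff hHD hI hXC (k := 1) (p := 1) (q := 0) rfl _).1 (hcC0' i)
  · exact (BettiUniverse.mem_hodge_piece_iff hHD hI hXC (k := 1) (p := 0) (q := 1) rfl _).1 (hcC1' i)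
  intro p hp c hcQ hc
  -- the presentation `H¹(A × C) = pr_A^* H¹(A) ⊕ pr_C^* H¹(C)` and its complexification
  set ι₁ := HOneProduct.pullFst A C with hι₁
  set π₁ := HOneProduct.pullInl A C with hπ₁
  set ι₂ := HOneProduct.pullSnd A C with hι₂
  set π₂ := HOneProduct.pullInr A C with hπ₂
  have hπι₁ : π₁ ∘ₗ ι₁ = LinearMap.id := HOneProduct.pullInl_comp_pullFst
  have hπι₂ : π₂ ∘ₗ ι₂ = LinearMap.id := HOneProduct.pullInr_comp_pullSnd
  have hπ₁ι₂ : π₁ ∘ₗ ι₂ = 0 := HOneProduct.pullInl_comp_pullSnd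
  have hπ₂ι₁ : π₂ ∘ₗ ι₁ = 0 := HOneProduct.pullInr_comp_pullFst
  have hsum : ι₁ ∘ₗ π₁ + ι₂ ∘ₗ π₂ = LinearMap.id := HOneProduct.pullFst_comp_pullInl_add
  have hπι₁C : π₁.baseChange ℂ ∘ₗ ι₁.baseChange ℂ = LinearMap.id := by
    rw [← LinearMap.baseChange_comp, hπι₁, LinearMap.baseChange_id]
  have hπι₂C : π₂.baseChange ℂ ∘ₗ ι₂.baseChange ℂ = LinearMap.id := by
    rw [← LinearMap.baseChange_comp, hπι₂, LinearMap.baseChange_id]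
  have hπ₁ι₂C : π₁.baseChange ℂ ∘ₗ ι₂.baseChange ℂ = 0 := by
    rw [← LinearMap.baseChange_comp, hπ₁ι₂, LinearMap.baseChange_zero]
  have hπ₂ι₁C : π₂.baseChange ℂ ∘ₗ ι₁.baseChange ℂ = 0 := by
    rw [← LinearMap.baseChange_comp, hπ₂ι₁, LinearMap.baseChange_zero]
  have hsumC : ι₁.baseChange ℂ ∘ₗ π₁.baseChange ℂ + ι₂.baseChange ℂ ∘ₗ π₂.baseChange ℂ = LinearMap.id := by
    rw [← LinearMap.baseChange_comp, ← LinearMap.baseChange_comp, ← LinearMap.baseChange_add, hsum,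
      LinearMap.baseChange_id]
  -- piece compatibility of `pr_A^*`, `pr_C^*` (pull-backs are morphisms of Hodge structures)
  have hι₁F : ∀ q : ℤ, ∀ x ∈ (BettiUniverse.hodge hHD hXA 1).piece q (((1 : ℕ) : ℤ) - q), ι₁.baseChange ℂ x ∈ (BettiUniverse.hodge hHD hXP 1).piece q (((1 : ℕ) : ℤ) - q) :=
    fun q x hx => (BettiUniverse.pullHodgeHom hHD hI hXP hXA (Motives.AbelianVariety.fst A C).hom.hom.hom 1).map_piece_le
      q _ ⟨x, hx, rfl⟩
  have hι₂F : ∀ q : ℤ, ∀ x ∈ (BettiUniverse.hodge hHD hXC 1).piece q (((1 : ℕ) : ℤ) - q), ι₂.baseChange ℂ x ∈ (BettiUniverse.hodge hHD hXP 1).piece q (((1 : ℕ) : ℤ) - q) :=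
    fun q x hx => (BettiUniverse.pullHodgeHom hHD hI hXP hXC (Motives.AbelianVariety.snd A C).hom.hom.hom 1).map_piece_le
      q _ ⟨x, hx, rfl⟩
  -- §1: the basis `cbx` of `H¹(A × C) ⊗ ℂ` in pairs: `pr_A^* b_i^r` and `pr_C^* c_i^r`
  obtain ⟨cbx', hcbx'l, hcbx'r⟩ := exists_basis_of_presentation hπι₁C hπι₂C hπ₁ι₂C hπ₂ι₁C hsumC bA cC
  set cbx : Module.Basis ((Fin hA ⊕ Fin h) × Fin 2) ℂ (ℂ ⊗[ℚ] bettiCohomology (A.prod C).X 1) :=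
    cbx'.reindex (Equiv.sumProdDistrib (Fin hA) (Fin h) (Fin 2)).symm with hcbxdef
  have hcbx : ∀ tr : (Fin hA ⊕ Fin h) × Fin 2, cbx tr =
      Sum.elim (fun i => ι₁.baseChange ℂ (bA (i, tr.2))) (fun i => ι₂.baseChange ℂ (cC (i, tr.2))) tr.1 := by
    rintro ⟨t, r⟩
    rw [hcbxdef, Module.Basis.reindex_apply, Equiv.symm_symm]
    rcases t with i | i
    · rw [Equiv.sumProdDistrib_apply_left, hcbx'l]; rfl
    · rw [Equiv.sumProdDistrib_apply_right, hcbx'r]; rfl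
  -- Hodge-adaptedness of `cbx`
  have hcbx0 : ∀ t, cbx (t, 0) ∈ (BettiUniverse.hodge hHD hXP 1).piece 1 0 := by
    intro t
    rw [hcbx]
    rcases t with i | i
    · exact hι₁F 1 _ (by simpa using hbA0' i)
    · exact hι₂F 1 _ (by simpa using hcC0' i)
  have hcbx1 : ∀ t, cbx (t, 1) ∈ (BettiUniverse.hodge hHD hXP 1).piece 0 1 := by
    intro t
    rw [hcbx]
    rcases t with i | i
    · have e : (((1 : ℕ) : ℤ) - 0) = 1 := by norm_num
      have h01 := hι₁F 0 _ (by rw [e]; exact hbA1' i)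
      rwa [e] at h01
    · have e : (((1 : ℕ) : ℤ) - 0) = 1 := by norm_num
      have h01 := hι₂F 0 _ (by rw [e]; exact hcC1' i)
      rwa [e] at h01
  -- bases indexed by `Fin M`: the pair basis `cbσ` and the rational basis `eC`
  set eQ := Module.finBasis ℚ (bettiCohomology (A.prod C).X 1) with heQ
  set eC : Module.Basis (Fin (Module.finrank ℚ (bettiCohomology (A.prod C).X 1))) ℂ
    (ℂ ⊗[ℚ] bettiCohomology (A.prod C).X 1) := Algebra.TensorProduct.basis ℂ eQ with heC
  set φ : Fin (Module.finrank ℚ (bettiCohomology (A.prod C).X 1)) ≃ (Fin hA ⊕ Fin h) × Fin 2 :=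
    eC.indexEquiv cbx with hφ
  set cbσ : Module.Basis (Fin (Module.finrank ℚ (bettiCohomology (A.prod C).X 1))) ℂ
    (ℂ ⊗[ℚ] bettiCohomology (A.prod C).X 1) := cbx.reindex φ.symm with hcbσdef
  have hcbσ : ∀ m, cbσ m = cbx (φ m) := fun m => by
    rw [hcbσdef, Module.Basis.reindex_apply, Equiv.symm_symm]
  -- letters
  set ρ := ofRatClassBaseChangeEquiv hXP 1 with hρ
  set v : Module.Basis _ ℂ (complexBetti (A.prod C).X 1) := cbσ.map ρ with hv
  set eL : Module.Basis _ ℂ (complexBetti (A.prod C).X 1) := eC.map ρ with heL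
  have heLQ : ∀ i, IsRationalClass (eL i) := fun i => by
    rw [heL, Module.Basis.map_apply, heC, Algebra.TensorProduct.basis_apply, hρ,
      ofRatClassBaseChangeEquiv_apply, ofRatClassBaseChange_tmul, one_smul]
    exact isRationalClass_ofRatClass _
  set κ : Fin (Module.finrank ℚ (bettiCohomology (A.prod C).X 1)) → Fin 2 := fun m => (φ m).2 with hκ
  have hv_apply : ∀ m, v m = ofRatClassBaseChange (Motives.ComplexPoints (A.prod C).X) 1 (cbx (φ m)) := fun m => by
    rw [hv, Module.Basis.map_apply, hcbσ, hρ, ofRatClassBaseChangeEquiv_apply]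
  have hv0 : ∀ m, κ m = 0 → IsOfHodgeType (A.prod C).dim (A.prod C).X 1 1 0 (v m) := by
    intro m hm
    rw [hv_apply, ← BettiUniverse.mem_hodge_piece_iff hHD hI hXP (k := 1) (p := 1) (q := 0) rfl]
    have hsplit : φ m = ((φ m).1, 0) := by
      change (φ m).2 = 0 at hm; rw [← hm]
    rw [hsplit]
    exact hcbx0 _
  have hv1 : ∀ m, κ m = 1 → IsOfHodgeType (A.prod C).dim (A.prod C).X 1 0 1 (v m) := by
    intro m hm
    rw [hv_apply, ← BettiUniverse.mem_hodge_piece_iff hHD hI hXP (k := 1) (p := 0) (q := 1) rfl]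
    have hsplit : φ m = ((φ m).1, 1) := by
      change (φ m).2 = 1 at hm; rw [← hm]
    rw [hsplit]
    exact hcbx1 _
  -- (α) an antisymmetric kind-balanced coefficient function in the adapted letters
  obtain ⟨ax, hax_bal, hax_anti, hcax⟩ := hg.exists_antisymm_kindBalanced_wordEval_eq v κ hv0 hv1 hp hc
  -- the change of letters to the rational letters
  set G : Matrix _ _ ℂ := eC.toMatrix cbσ with hG
  set G' : Matrix _ _ ℂ := cbσ.toMatrix eC with hG'
  have hG'G : G' * G = 1 := cbσ.toMatrix_mul_toMatrix_flip eC
  have hve : ∀ m, v m = ∑ i, G i m • eL i := fun m => by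
    simp only [hv, heL, Module.Basis.map_apply, ← map_smul, ← map_sum]
    congr 1
    exact (eC.sum_toMatrix_smul_self (v := ⇑cbσ) (j := m)).symm
  have hletters : ∀ j m, avLetters g v (j, m) = ∑ i, G i m • avLetters g eL (j, i) :=
    avLetters_baseChange g G hve
  set aE := colourChangeAt (fun _ : Fin n => G) ax with haE
  have haE_anti : IsAntisymm aE := hax_anti.colourChangeAt _
  have hcaE : wordEval (cupPowOneAlt ℂ (Motives.ComplexPoints X.X) (2 * p)) (avLetters g eL) aE = c := by
    rw [haE, ← wordEval_eq_wordEval_colourChangeAt _ (fun _ : Fin n => G) hletters ax, hcax]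
  -- rationality of `aE`
  have hFinj : Function.Injective (exteriorPower.alternatingMapLinearEquiv
      (cupPowOneAlt ℂ (Motives.ComplexPoints X.X) (2 * p))) :=
    injective_alternatingMapLinearEquiv_cupPowOneAlt X (2 * p)
  obtain ⟨q, hq⟩ := hg.exists_rat_wordEval_eq eL heLQ hcQ
  obtain ⟨q', -, haEq⟩ := haE_anti.exists_eq_algebraMap_of_wordEval_eq hFinj (hg.letterBasis eL)
    (q := q) (by rw [AVSlots.coe_letterBasis, hcaE, hq])
  have hslice_e : ∀ u, wordSlice aE u = wordRepAt ℂ (fun _ : Fin (2 * p) => G) (wordSlice ax u) :=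
    fun u => wordSlice_colourChangeAt (fun _ : Fin n => G) ax u
  -- the Hodge operator `Θ` of `H¹(A × C)`: `diag(±1)` in the adapted letters
  obtain ⟨Θ, hΘ⟩ := exists_hodgeTheta (BettiUniverse.hodge hHD hXP 1)
  have hΘb : ∀ m, Θ (cbσ m) = (if κ m = 0 then (1 : ℂ) else -1) • cbσ m := by
    intro m
    rw [hcbσ]
    change Θ _ = (if (φ m).2 = 0 then (1 : ℂ) else -1) • _
    rcases fin2_eq_zero_or_one_ct (φ m).2 with h0 | h1
    · rw [h0, if_pos rfl]
      have hmem : cbx (φ m) ∈ (BettiUniverse.hodge hHD hXP 1).piece 1 (((1 : ℕ) : ℤ) - 1) := by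
        have e : (((1 : ℕ) : ℤ) - 1) = 0 := by norm_num
        have hsplit : φ m = ((φ m).1, 0) := by rw [← h0]
        rw [e, hsplit]; exact hcbx0 _
      rw [hΘ 1 _ hmem]
      norm_num
    · rw [h1, if_neg one_ne_zero]
      have hmem : cbx (φ m) ∈ (BettiUniverse.hodge hHD hXP 1).piece 0 (((1 : ℕ) : ℤ) - 0) := by
        have e : (((1 : ℕ) : ℤ) - 0) = 1 := by norm_num
        have hsplit : φ m = ((φ m).1, 1) := by rw [← h1]
        rw [e, hsplit]; exact hcbx1 _
      rw [hΘ 0 _ hmem]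
      norm_num
  have hΘcb : LinearMap.toMatrix cbσ cbσ Θ = kindDiag κ := by
    ext i m
    rw [LinearMap.toMatrix_apply, hΘb, map_smul, Module.Basis.repr_self, Finsupp.smul_apply,
      Finsupp.single_apply, kindDiag, Matrix.diagonal_apply, smul_eq_mul, mul_ite, mul_one, mul_zero]
    by_cases him : i = m
    · subst him; rw [if_pos rfl]
    · rw [if_neg (Ne.symm him), if_neg him]
  have hJG : LinearMap.toMatrix eC eC Θ * G = G * kindDiag κ := by
    rw [← hΘcb, hG, linearMap_toMatrix_mul_basis_toMatrix, basis_toMatrix_mul_linearMap_toMatrix]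
  have hΘq : ∀ u : Fin (2 * p) → Fin n, wordDerAt ℂ (fun _ : Fin (2 * p) => LinearMap.toMatrix eC eC Θ)
      (wordSlice (fun w => algebraMap ℚ ℂ (q' w)) u) = 0 := by
    intro u
    rw [← haEq, hslice_e]
    refine wordDerAt_wordRepAt_eq_zero_of_mul_eq ℂ (fun _ : Fin (2 * p) => G) (fun _ => hJG) ?_
    rw [wordDerAt_const]
    exact wordDer_kindDiag_wordSlice_eq_zero κ hax_bal u
  -- polarizations of `H¹(A)`, `H¹(C)`
  obtain ⟨ψ⟩ : (BettiUniverse.hodge hHD (AbelianVariety.isSmoothProjective_holds (A := A)) 1).IsPolarizable :=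
    smoothProjective_hodgeStructure_isPolarizable_holds hXA (BettiUniverse.realHodgeModel hHD hXA)
      (BettiUniverse.realHodgeModel_isHodgeSymmetric hHD hXA) 1
  obtain ⟨ψC⟩ : (BettiUniverse.hodge hHD (AbelianVariety.isSmoothProjective_holds (A := C)) 1).IsPolarizable :=
    smoothProjective_hodgeStructure_isPolarizable_holds hXC (BettiUniverse.realHodgeModel hHD hXC)
      (BettiUniverse.realHodgeModel_isHodgeSymmetric hHD hXC) 1
  -- the Hodge operators `Θ_A`, `Θ_C` and the partial Hodge operator `Y = pr_A^* ∘ Θ_A ∘ ι_A^*`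
  obtain ⟨ΘA, hΘA⟩ := exists_hodgeTheta (BettiUniverse.hodge hHD hXA 1)
  obtain ⟨ΘC, hΘC⟩ := exists_hodgeTheta (BettiUniverse.hodge hHD hXC 1)
  set Y := ι₁.baseChange ℂ ∘ₗ ΘA ∘ₗ π₁.baseChange ℂ with hY
  -- the rational data `χ^*` and (NONRES) for the chosen `Θ_A`, `Θ_C`, restricted to `ψ`-skew `b`
  have hχE := pullback_mem_endAlg hHD hI χ
  have hχ2 : (bettiCohomology.map χ.hom.hom.hom 1).hom * (bettiCohomology.map χ.hom.hom.hom 1).hom =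
      -((d' : ℚ) • 1) := bettiMapHom_mul_self hχ
  have hd'Q : (0 : ℚ) < d' := Nat.cast_pos.2 hd'
  have hV₂ : Module.finrank ℚ (bettiCohomology C.X 1) = 2 := by rw [finrank_bettiCohomology_one C, hC1]
  have hres : ∀ b ∈ (BettiUniverse.hodge hHD hXA 1).endAlg,
      (∀ a ∈ (BettiUniverse.hodge hHD hXA 1).endAlg, b * a = a * b) →
      (∀ v w, ψ.form (b v) w + ψ.form v (b w) = 0) →
      ((LinearMap.trace ℚ _ ((bettiCohomology.map χ.hom.hom.hom 1).hom *
          (bettiCohomology.map χ.hom.hom.hom 1).hom) : ℚ) : ℂ) * LinearMap.trace ℂ _ (ΘA * b.baseChange ℂ) ≠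
        LinearMap.trace ℂ _ (ΘC * (bettiCohomology.map χ.hom.hom.hom 1).hom.baseChange ℂ) :=
    fun b hb hbc _ => hNR hΘA hΘC b hb hbc
  -- the product Lie step: `Y` kills the rational coefficient tensor
  have hL : ∀ u : Fin (2 * p) → Fin n, wordDerAt ℂ (fun _ : Fin (2 * p) => LinearMap.toMatrix eC eC Y)
      (wordSlice (fun w => algebraMap ℚ ℂ (q' w)) u) = 0 := fun u =>
    wordDerAt_incl_theta_proj_eq_zero_of_centre_times_cmCurve hn1 (BettiUniverse.hodge hHD hXP 1)
      (BettiUniverse.hodge hHD hXA 1) (BettiUniverse.hodge hHD hXC 1) (BettiUniverse.hodge_isEffective hHD hXA 1)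
      (BettiUniverse.hodge_isEffective hHD hXC 1) hπι₁ hπι₂ hπ₁ι₂ hπ₂ι₁ hsum hι₁F hι₂F ψ ψC hχE hd'Q hχ2 hV₂
      eQ q' hΘ hΘA hΘC hres hΘq u
  -- the diagonal weights of `Y` in the pair letters: `±1` at the `A`-places, `0` at the `C`-places
  set δ₀ : Fin hA ⊕ Fin h → Fin 2 → ℂ :=
    Sum.elim (fun (_ : Fin hA) (r : Fin 2) => if r = 0 then (1 : ℂ) else -1) (fun (_ : Fin h) (_ : Fin 2) => (0 : ℂ))
    with hδ₀
  set D : Fin hA ⊕ Fin h → Matrix (Fin 2) (Fin 2) ℂ := fun t => Matrix.diagonal (δ₀ t) with hD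
  have hYG : ∀ _t : Fin (2 * p), LinearMap.toMatrix eC eC Y * G = G * LinearMap.toMatrix cbσ cbσ Y :=
    fun _ => by rw [hG, linearMap_toMatrix_mul_basis_toMatrix, basis_toMatrix_mul_linearMap_toMatrix]
  have e11 : ∀ x, π₁.baseChange ℂ (ι₁.baseChange ℂ x) = x := fun x => by
    rw [← LinearMap.comp_apply (f := π₁.baseChange ℂ), hπι₁C, LinearMap.id_apply]
  have e12 : ∀ y, π₁.baseChange ℂ (ι₂.baseChange ℂ y) = 0 := fun y => by
    rw [← LinearMap.comp_apply (f := π₁.baseChange ℂ), hπ₁ι₂C, LinearMap.zero_apply]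
  -- `Θ_A` on the pair basis of `H¹(A) ⊗ ℂ`
  have hΘAb : ∀ (i : Fin hA) (r : Fin 2), ΘA (bA (i, r)) = (if r = 0 then (1 : ℂ) else -1) • bA (i, r) := by
    intro i r
    rcases fin2_eq_zero_or_one_ct r with h0 | h1
    · rw [h0, if_pos rfl]
      have hmem : bA (i, 0) ∈ (BettiUniverse.hodge hHD hXA 1).piece 1 (((1 : ℕ) : ℤ) - 1) := by
        have e : (((1 : ℕ) : ℤ) - 1) = 0 := by norm_num
        rw [e]; exact hbA0' i
      rw [hΘA 1 _ hmem]
      norm_num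
    · rw [h1, if_neg one_ne_zero]
      have hmem : bA (i, 1) ∈ (BettiUniverse.hodge hHD hXA 1).piece 0 (((1 : ℕ) : ℤ) - 0) := by
        have e : (((1 : ℕ) : ℤ) - 0) = 1 := by norm_num
        rw [e]; exact hbA1' i
      rw [hΘA 0 _ hmem]
      norm_num
  have hblk : LinearMap.toMatrix cbσ cbσ Y = blockLift φ D := by
    refine toMatrix_eq_blockLift_of_apply_basis φ cbσ _ Y fun m => ?_
    rw [hcbσ m]
    have hb' : ∀ a, cbσ (φ.symm ((φ m).1, a)) = cbx ((φ m).1, a) := fun a => by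
      rw [hcbσ, Equiv.apply_symm_apply]
    simp only [hb']
    obtain ⟨t, r⟩ := φ m
    rcases t with i | i
    · simp only [hcbx, Sum.elim_inl]
      rw [hY, LinearMap.comp_apply, LinearMap.comp_apply, e11, hΘAb, map_smul,
        Finset.sum_eq_single r]
      · rw [hD]
        simp only [hδ₀, Sum.elim_inl, Matrix.diagonal_apply_eq]
      · intro a _ ha
        rw [hD]
        simp only [Matrix.diagonal_apply_ne _ ha, zero_smul]
      · intro hr; exact absurd (Finset.mem_univ r) hr
    · simp only [hcbx, Sum.elim_inr]
      rw [hY, LinearMap.comp_apply, LinearMap.comp_apply, e12, map_zero, map_zero]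
      symm
      refine Finset.sum_eq_zero fun a _ => ?_
      have h0 : D (Sum.inr i) a r = 0 := by
        simp [hD, hδ₀, Matrix.diagonal_apply]
      rw [h0, zero_smul]
  -- `Y` kills the coefficient tensor in the pair letters
  have hax : ∀ u : Fin (2 * p) → Fin n, wordDerAt ℂ (fun _ : Fin (2 * p) => blockLift φ D) (wordSlice ax u) = 0 := by
    intro u
    have hLu := hL u
    rw [← haEq, hslice_e] at hLu
    have h3 : wordRepAt ℂ (fun _ : Fin (2 * p) => G)
        (wordDerAt ℂ (fun _ : Fin (2 * p) => blockLift φ D) (wordSlice ax u)) = 0 := by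
      rw [← hblk, wordRepAt_wordDerAt_of_mul_eq ℂ (fun _ : Fin (2 * p) => G) hYG, hLu]
    exact wordRepAt_injective ℂ (g := fun _ : Fin (2 * p) => G) (g' := fun _ : Fin (2 * p) => G')
      (funext fun _ => hG'G) (by rw [h3, map_zero])
  -- the coefficient function, refined to slot-and-place colours
  refine ⟨placeRefine φ ax, ?_, fun U η hU => ?_⟩
  · rw [← hcax]
    have hx : (fun jr : (Fin n × (Fin hA ⊕ Fin h)) × Fin 2 => avLetters g v (jr.1.1, φ.symm (jr.1.2, jr.2))) =
        fun jr : (Fin n × (Fin hA ⊕ Fin h)) × Fin 2 => complexBetti.map (g jr.1.1).hom.hom.hom 1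
          (Sum.elim
            (fun i => complexBetti.map (Motives.AbelianVariety.fst A C).hom.hom.hom 1
              (ofRatClassBaseChange (Motives.ComplexPoints A.X) 1 (bA (i, jr.2))))
            (fun i => complexBetti.map (Motives.AbelianVariety.snd A C).hom.hom.hom 1
              (ofRatClassBaseChange (Motives.ComplexPoints C.X) 1 (cC (i, jr.2))))
            jr.1.2) := by
      funext jr
      rw [avLetters_apply, hv_apply, Equiv.apply_symm_apply, hcbx]
      obtain ⟨⟨j, t⟩, r⟩ := jr
      rcases t with i | i
      · simp only [Sum.elim_inl]
        congr 1
        rw [hι₁, ← ofRatClassBaseChangeEquiv_apply (hX := hXP), ← ofRatClassBaseChangeEquiv_apply (hX := hXA),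
          complexBetti_map_ofRatClassBaseChangeEquiv hXP hXA]
      · simp only [Sum.elim_inr]
        congr 1
        rw [hι₂, ← ofRatClassBaseChangeEquiv_apply (hX := hXP), ← ofRatClassBaseChangeEquiv_apply (hX := hXC),
          complexBetti_map_ofRatClassBaseChangeEquiv hXP hXC]
    rw [← hx]
    exact wordEval_placeRefine _ φ (avLetters g v) ax
  · -- the blocks of `Y` placed by place kill the refined slices; read off the diagonal weights
    have h1 := wordDerAt_placeFamily_placeRefine_eq_zero φ D hax U
    have h2 : wordDerAt ℂ (fun t => Matrix.diagonal (δ₀ (U t).2)) (wordSlice (placeRefine φ ax) U) = 0 := h1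
    have h3 := eq_zero_of_wordDerAt_diagonal_eq_zero (fun t => δ₀ (U t).2) h2 η (by
      have hsum_eq : ∑ t, δ₀ (U t).2 (η t) =
          ∑ t, Sum.elim (fun _ : Fin hA => if η t = 0 then (1 : ℂ) else -1) (fun _ : Fin h => (0 : ℂ)) (U t).2 := by
        refine Finset.sum_congr rfl fun t _ => ?_
        rw [hδ₀]
        exact sum_elim_kindWeight_apply (U t).2 (η t)
      rw [hsum_eq]; exact hU)
    rw [wordSlice_apply] at h3
    exact h3


end Invariance

/-! ### §4 The product span for `A × E` under (NONRES) -/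

section ProductSpanOpens

open MonoidalCategory CartesianMonoidalCategory

section ProductSpan

variable {A B C Z : AbelianVariety ℂ} {n : ℕ} {gB : Fin n → (B ⟶ A)} {gC : Fin n → (Z ⟶ C)}

/-- **`HodgeClassesProductSpan B Z` for slots over `A × C`, `A` ARBITRARY, `C` an elliptic curve with
`χ ≫ χ = -d'`, under the trace non-resonance (NONRES)** (Moonen–Zarhin (3.1) with Prop. (3.8), PROVED with slots: `B`
with `n` slots over `A`, `Z` with `n` slots over `C`, e.g. `B = A^{N+1}`, `Z = C^{N+1}`): every rational class of
Hodge type `(p,p)` on `B × Z` is a `ℂ`-combination of exterior products `pr_B^* a ⌣ pr_Z^* b` of RATIONAL HODGE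
classes — the tree's `hodgeClassesProductSpan_of_avSlots_of_quadraticEnd_cmCurve` verbatim, fed by the invariance
theorem `AVSlots.exists_coeff_eq_zero_off_balanced_of_prod_centre_cmCurve`.
[cite: MoonenZarhin1999LowDim, §3 (3.1) and Prop. (3.8)] [cite: Lombardo2016, Lemma 3.4 (p. 1229)] -/
theorem hodgeClassesProductSpan_of_avSlots_of_centre_cmCurve
    (hC1 : C.dim = 1) (χ : C ⟶ C) {d' : ℕ} (hd' : 0 < d') (hχ : χ ≫ χ = -(d' • 𝟙 C))
    (hNR : ∀ {ΘA : Module.End ℂ (ℂ ⊗[ℚ] bettiCohomology A.X 1)},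
      (∀ p, ∀ x ∈ (BettiUniverse.hodge exists_isReal_hodgeModel_holds
        (AbelianVariety.isSmoothProjective_holds (A := A)) 1).piece p (((1 : ℕ) : ℤ) - p),
        ΘA x = ((2 * p - ((1 : ℕ) : ℤ) : ℤ) : ℂ) • x) →
      ∀ {ΘC : Module.End ℂ (ℂ ⊗[ℚ] bettiCohomology C.X 1)},
      (∀ p, ∀ x ∈ (BettiUniverse.hodge exists_isReal_hodgeModel_holds
        (AbelianVariety.isSmoothProjective_holds (A := C)) 1).piece p (((1 : ℕ) : ℤ) - p),
        ΘC x = ((2 * p - ((1 : ℕ) : ℤ) : ℤ) : ℂ) • x) →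
      ∀ b ∈ (BettiUniverse.hodge exists_isReal_hodgeModel_holds
        (AbelianVariety.isSmoothProjective_holds (A := A)) 1).endAlg,
      (∀ a ∈ (BettiUniverse.hodge exists_isReal_hodgeModel_holds
        (AbelianVariety.isSmoothProjective_holds (A := A)) 1).endAlg, b * a = a * b) →
      ((LinearMap.trace ℚ _ ((bettiCohomology.map χ.hom.hom.hom 1).hom *
          (bettiCohomology.map χ.hom.hom.hom 1).hom) : ℚ) : ℂ) * LinearMap.trace ℂ _ (ΘA * b.baseChange ℂ) ≠
        LinearMap.trace ℂ _ (ΘC * (bettiCohomology.map χ.hom.hom.hom 1).hom.baseChange ℂ))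
    (hgB : AVSlots A B gB) (hgC : AVSlots C Z gC) :
    HodgeClassesProductSpan B Z := by
  classical
  intro p c hcQ hc
  have hB : IsSmoothProjective B.dim B.X := Motives.AbelianVariety.isSmoothProjective_holds
  have hZ : IsSmoothProjective Z.dim Z.X := Motives.AbelianVariety.isSmoothProjective_holds
  have hXA : IsSmoothProjective A.dim A.X := Motives.AbelianVariety.isSmoothProjective_holds
  have hXC : IsSmoothProjective C.dim C.X := Motives.AbelianVariety.isSmoothProjective_holds
  obtain ⟨hA, bA, h, cC, hbA0, hbA1, hcC0, hcC1, hmain⟩ :=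
    (hgB.prodLift hgC).exists_coeff_eq_zero_off_balanced_of_prod_centre_cmCurve hC1 χ hd' hχ hNR
  have hc' : IsOfHodgeType (B.prod Z).dim (B.prod Z).X (2 * p) p p c := by
    rw [Motives.AbelianVariety.dim_prod]; exact hc
  rcases Nat.eq_zero_or_pos p with rfl | hp
  · -- degree `0`: `c = s · 1 = pr_B^*(s · 1_B) ⌣ pr_Z^* 1_Z`
    have h1 : c ∈ Submodule.span ℂ {singularCohomology.one ℂ (ComplexPoints (B.X ⊗ Z.X))} :=
      mem_divisorClassesSpan_zero (N := B.dim + Z.dim) (IsSmoothProjective.tensor_holds hB hZ) c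
    obtain ⟨s, hs⟩ := Submodule.mem_span_singleton.1 h1
    refine mem_span_hodgeProductClasses_of_mem_span_pureType B Z hcQ hc (Submodule.subset_span ?_)
    refine ⟨0, 0, rfl, s • singularCohomology.one ℂ (ComplexPoints B.X), singularCohomology.one ℂ (ComplexPoints Z.X),
      ⟨0, rfl, isOfHodgeType_zero_zero_of_degree_zero hB _⟩,
      ⟨0, 0, rfl, isOfHodgeType_zero_zero_of_degree_zero hZ _⟩, ?_⟩
    rw [← hs, map_smul, LinearMap.map_smul₂]
    erw [singularCohomology.map_one, singularCohomology.map_one, cupProduct_one]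
  · obtain ⟨a, hca, hkill⟩ := hmain hp hcQ hc'
    -- the letters of `B × Z` over `A × C` are `pr_B^*`(letters of `B` over `A`) and `pr_Z^*`(letters of `Z` over `C`)
    set xA : (Fin n × Fin hA) × Fin 2 → complexBetti B.X 1 := fun jr =>
      complexBetti.map (gB jr.1.1).hom.hom.hom 1 (ofRatClassBaseChange (ComplexPoints A.X) 1 (bA (jr.1.2, jr.2)))
      with hxA
    set y : (Fin n × Fin h) × Fin 2 → complexBetti Z.X 1 := fun jr =>
      complexBetti.map (gC jr.1.1).hom.hom.hom 1 (ofRatClassBaseChange (ComplexPoints C.X) 1 (cC (jr.1.2, jr.2)))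
      with hy
    have hletters : (fun jr : (Fin n × (Fin hA ⊕ Fin h)) × Fin 2 => complexBetti.map
        (Motives.AbelianVariety.prodLift (Motives.AbelianVariety.fst B Z ≫ gB jr.1.1)
          (Motives.AbelianVariety.snd B Z ≫ gC jr.1.1)).hom.hom.hom 1
        (Sum.elim
          (fun i => complexBetti.map (Motives.AbelianVariety.fst A C).hom.hom.hom 1
            (ofRatClassBaseChange (ComplexPoints A.X) 1 (bA (i, jr.2))))
          (fun i => complexBetti.map (Motives.AbelianVariety.snd A C).hom.hom.hom 1
            (ofRatClassBaseChange (ComplexPoints C.X) 1 (cC (i, jr.2))))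
          jr.1.2)) =
        fun jr : (Fin n × (Fin hA ⊕ Fin h)) × Fin 2 => Sum.elim
          (fun i => complexBetti.map (Motives.AbelianVariety.fst B Z).hom.hom.hom 1 (xA ((jr.1.1, i), jr.2)))
          (fun i => complexBetti.map (Motives.AbelianVariety.snd B Z).hom.hom.hom 1 (y ((jr.1.1, i), jr.2)))
          jr.1.2 := by
      funext jr
      obtain ⟨⟨j, t⟩, κ⟩ := jr
      rcases t with i | i
      · simp only [Sum.elim_inl, hxA]
        rw [complexBetti_map_map_hom, complexBetti_map_map_hom, Motives.AbelianVariety.prodLift_fst]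
      · simp only [Sum.elim_inr, hy]
        rw [complexBetti_map_map_hom, complexBetti_map_map_hom, Motives.AbelianVariety.prodLift_snd]
    -- types of the letters
    have hxA0 : ∀ jr : (Fin n × Fin hA) × Fin 2, jr.2 = 0 → IsOfHodgeType B.dim B.X 1 1 0 (xA jr) := by
      rintro ⟨⟨j, i⟩, κ⟩ hκ
      change κ = 0 at hκ
      subst hκ
      exact (hbA0 i).map_of_isSmoothProjective hB hXA _
    have hxA1 : ∀ jr : (Fin n × Fin hA) × Fin 2, jr.2 = 1 → IsOfHodgeType B.dim B.X 1 0 1 (xA jr) := by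
      rintro ⟨⟨j, i⟩, κ⟩ hκ
      change κ = 1 at hκ
      subst hκ
      exact (hbA1 i).map_of_isSmoothProjective hB hXA _
    have hy0 : ∀ jr : (Fin n × Fin h) × Fin 2, jr.2 = 0 → IsOfHodgeType Z.dim Z.X 1 1 0 (y jr) := by
      rintro ⟨⟨j, i⟩, κ⟩ hκ
      change κ = 0 at hκ
      subst hκ
      exact (hcC0 i).map_of_isSmoothProjective hZ hXC _
    have hy1 : ∀ jr : (Fin n × Fin h) × Fin 2, jr.2 = 1 → IsOfHodgeType Z.dim Z.X 1 0 1 (y jr) := by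
      rintro ⟨⟨j, i⟩, κ⟩ hκ
      change κ = 1 at hκ
      subst hκ
      exact (hcC1 i).map_of_isSmoothProjective hZ hXC _
    -- evaluate and feed the typed criterion
    have hmem := wordEval_mem_span_typed_cup_pureType_of_eq_zero_off_balanced
      (Motives.AbelianVariety.fst B Z) (Motives.AbelianVariety.snd B Z) xA y hxA0 hxA1 hy0 hy1 hkill
    rw [← hletters, hca] at hmem
    refine mem_span_hodgeProductClasses_of_mem_span_pureType B Z hcQ hc (Submodule.span_mono ?_ hmem)
    rintro z ⟨i, j, hij, d, μ, hd, hμ, rfl⟩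
    exact ⟨i, j, hij, d, μ, hd, hμ, rfl⟩

/-- **Equal powers**: `HodgeClassesProductSpan (A^{N+1}) (C^{N+1})` (by slots `AVSlots.powSucc` on both sides).
[cite: MoonenZarhin1999LowDim, §3 (3.1) and Prop. (3.8)] [cite: Lombardo2016, Lemma 3.4 (p. 1229)] -/
theorem hodgeClassesProductSpan_powSucc_powSucc_of_centre_cmCurve
    (hC1 : C.dim = 1) (χ : C ⟶ C) {d' : ℕ} (hd' : 0 < d') (hχ : χ ≫ χ = -(d' • 𝟙 C))
    (hNR : ∀ {ΘA : Module.End ℂ (ℂ ⊗[ℚ] bettiCohomology A.X 1)},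
      (∀ p, ∀ x ∈ (BettiUniverse.hodge exists_isReal_hodgeModel_holds
        (AbelianVariety.isSmoothProjective_holds (A := A)) 1).piece p (((1 : ℕ) : ℤ) - p),
        ΘA x = ((2 * p - ((1 : ℕ) : ℤ) : ℤ) : ℂ) • x) →
      ∀ {ΘC : Module.End ℂ (ℂ ⊗[ℚ] bettiCohomology C.X 1)},
      (∀ p, ∀ x ∈ (BettiUniverse.hodge exists_isReal_hodgeModel_holds
        (AbelianVariety.isSmoothProjective_holds (A := C)) 1).piece p (((1 : ℕ) : ℤ) - p),
        ΘC x = ((2 * p - ((1 : ℕ) : ℤ) : ℤ) : ℂ) • x) →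
      ∀ b ∈ (BettiUniverse.hodge exists_isReal_hodgeModel_holds
        (AbelianVariety.isSmoothProjective_holds (A := A)) 1).endAlg,
      (∀ a ∈ (BettiUniverse.hodge exists_isReal_hodgeModel_holds
        (AbelianVariety.isSmoothProjective_holds (A := A)) 1).endAlg, b * a = a * b) →
      ((LinearMap.trace ℚ _ ((bettiCohomology.map χ.hom.hom.hom 1).hom *
          (bettiCohomology.map χ.hom.hom.hom 1).hom) : ℚ) : ℂ) * LinearMap.trace ℂ _ (ΘA * b.baseChange ℂ) ≠
        LinearMap.trace ℂ _ (ΘC * (bettiCohomology.map χ.hom.hom.hom 1).hom.baseChange ℂ))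
    (N : ℕ) : HodgeClassesProductSpan (A.powSucc N) (C.powSucc N) :=
  hodgeClassesProductSpan_of_avSlots_of_centre_cmCurve hC1 χ hd' hχ hNR (AVSlots.powSucc A N) (AVSlots.powSucc C N)

/-- One slot on each side: `HodgeClassesProductSpan A C`. [cite: MoonenZarhin1999LowDim, §3 (3.1) and Prop. (3.8)] -/
theorem hodgeClassesProductSpan_of_centre_cmCurve
    (hC1 : C.dim = 1) (χ : C ⟶ C) {d' : ℕ} (hd' : 0 < d') (hχ : χ ≫ χ = -(d' • 𝟙 C))
    (hNR : ∀ {ΘA : Module.End ℂ (ℂ ⊗[ℚ] bettiCohomology A.X 1)},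
      (∀ p, ∀ x ∈ (BettiUniverse.hodge exists_isReal_hodgeModel_holds
        (AbelianVariety.isSmoothProjective_holds (A := A)) 1).piece p (((1 : ℕ) : ℤ) - p),
        ΘA x = ((2 * p - ((1 : ℕ) : ℤ) : ℤ) : ℂ) • x) →
      ∀ {ΘC : Module.End ℂ (ℂ ⊗[ℚ] bettiCohomology C.X 1)},
      (∀ p, ∀ x ∈ (BettiUniverse.hodge exists_isReal_hodgeModel_holds
        (AbelianVariety.isSmoothProjective_holds (A := C)) 1).piece p (((1 : ℕ) : ℤ) - p),
        ΘC x = ((2 * p - ((1 : ℕ) : ℤ) : ℤ) : ℂ) • x) →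
      ∀ b ∈ (BettiUniverse.hodge exists_isReal_hodgeModel_holds
        (AbelianVariety.isSmoothProjective_holds (A := A)) 1).endAlg,
      (∀ a ∈ (BettiUniverse.hodge exists_isReal_hodgeModel_holds
        (AbelianVariety.isSmoothProjective_holds (A := A)) 1).endAlg, b * a = a * b) →
      ((LinearMap.trace ℚ _ ((bettiCohomology.map χ.hom.hom.hom 1).hom *
          (bettiCohomology.map χ.hom.hom.hom 1).hom) : ℚ) : ℂ) * LinearMap.trace ℂ _ (ΘA * b.baseChange ℂ) ≠
        LinearMap.trace ℂ _ (ΘC * (bettiCohomology.map χ.hom.hom.hom 1).hom.baseChange ℂ)) :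
    HodgeClassesProductSpan A C :=
  hodgeClassesProductSpan_of_avSlots_of_centre_cmCurve hC1 χ hd' hχ hNR (avSlots_self A) (avSlots_self C)

end ProductSpan

end ProductSpanOpens

/-! ### §5 Condition (D) for `A × E` under (NONRES) -/

section ConditionD

variable {A C : AbelianVariety ℂ}

/-- **Condition (D) for `A × E` under (NONRES)**: if `A` is stably nondegenerate, `E` is an elliptic curve with
`χ ≫ χ = -d'`, and (NONRES) holds, then `A × E` is stably nondegenerate («`Hg(X × E) = Hg(X) × Hg(E)`» and Thm. (3.2):
product span on all equal powers + (D) for both factors; an elliptic curve is (D)).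
[cite: MoonenZarhin1999LowDim, §3 Thm. (3.2) and Prop. (3.8)] [cite: Gordon1999HodgeAVSurvey, Def. 7.6] -/
theorem IsStablyNondegenerate.prod_cmCurve_of_traceNonres (hA : IsStablyNondegenerate A)
    (hC1 : C.dim = 1) (χ : C ⟶ C) {d' : ℕ} (hd' : 0 < d') (hχ : χ ≫ χ = -(d' • 𝟙 C))
    (hNR : ∀ {ΘA : Module.End ℂ (ℂ ⊗[ℚ] bettiCohomology A.X 1)},
      (∀ p, ∀ x ∈ (BettiUniverse.hodge exists_isReal_hodgeModel_holds
        (AbelianVariety.isSmoothProjective_holds (A := A)) 1).piece p (((1 : ℕ) : ℤ) - p),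
        ΘA x = ((2 * p - ((1 : ℕ) : ℤ) : ℤ) : ℂ) • x) →
      ∀ {ΘC : Module.End ℂ (ℂ ⊗[ℚ] bettiCohomology C.X 1)},
      (∀ p, ∀ x ∈ (BettiUniverse.hodge exists_isReal_hodgeModel_holds
        (AbelianVariety.isSmoothProjective_holds (A := C)) 1).piece p (((1 : ℕ) : ℤ) - p),
        ΘC x = ((2 * p - ((1 : ℕ) : ℤ) : ℤ) : ℂ) • x) →
      ∀ b ∈ (BettiUniverse.hodge exists_isReal_hodgeModel_holds
        (AbelianVariety.isSmoothProjective_holds (A := A)) 1).endAlg,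
      (∀ a ∈ (BettiUniverse.hodge exists_isReal_hodgeModel_holds
        (AbelianVariety.isSmoothProjective_holds (A := A)) 1).endAlg, b * a = a * b) →
      ((LinearMap.trace ℚ _ ((bettiCohomology.map χ.hom.hom.hom 1).hom *
          (bettiCohomology.map χ.hom.hom.hom 1).hom) : ℚ) : ℂ) * LinearMap.trace ℂ _ (ΘA * b.baseChange ℂ) ≠
        LinearMap.trace ℂ _ (ΘC * (bettiCohomology.map χ.hom.hom.hom 1).hom.baseChange ℂ)) : IsStablyNondegenerate (A.prod C) :=
  isStablyNondegenerate_prod_of_forall_productSpan_powSucc A C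
    (fun N => hodgeClassesProductSpan_powSucc_powSucc_of_centre_cmCurve hC1 χ hd' hχ hNR N) hA
    (EllipticCurve.isStablyNondegenerate hC1)

/-- The order `E × A`. [cite: MoonenZarhin1999LowDim, §3 Thm. (3.2) and Prop. (3.8)] -/
theorem IsStablyNondegenerate.cmCurve_prod_of_traceNonres (hA : IsStablyNondegenerate A)
    (hC1 : C.dim = 1) (χ : C ⟶ C) {d' : ℕ} (hd' : 0 < d') (hχ : χ ≫ χ = -(d' • 𝟙 C))
    (hNR : ∀ {ΘA : Module.End ℂ (ℂ ⊗[ℚ] bettiCohomology A.X 1)},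
      (∀ p, ∀ x ∈ (BettiUniverse.hodge exists_isReal_hodgeModel_holds
        (AbelianVariety.isSmoothProjective_holds (A := A)) 1).piece p (((1 : ℕ) : ℤ) - p),
        ΘA x = ((2 * p - ((1 : ℕ) : ℤ) : ℤ) : ℂ) • x) →
      ∀ {ΘC : Module.End ℂ (ℂ ⊗[ℚ] bettiCohomology C.X 1)},
      (∀ p, ∀ x ∈ (BettiUniverse.hodge exists_isReal_hodgeModel_holds
        (AbelianVariety.isSmoothProjective_holds (A := C)) 1).piece p (((1 : ℕ) : ℤ) - p),
        ΘC x = ((2 * p - ((1 : ℕ) : ℤ) : ℤ) : ℂ) • x) →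
      ∀ b ∈ (BettiUniverse.hodge exists_isReal_hodgeModel_holds
        (AbelianVariety.isSmoothProjective_holds (A := A)) 1).endAlg,
      (∀ a ∈ (BettiUniverse.hodge exists_isReal_hodgeModel_holds
        (AbelianVariety.isSmoothProjective_holds (A := A)) 1).endAlg, b * a = a * b) →
      ((LinearMap.trace ℚ _ ((bettiCohomology.map χ.hom.hom.hom 1).hom *
          (bettiCohomology.map χ.hom.hom.hom 1).hom) : ℚ) : ℂ) * LinearMap.trace ℂ _ (ΘA * b.baseChange ℂ) ≠
        LinearMap.trace ℂ _ (ΘC * (bettiCohomology.map χ.hom.hom.hom 1).hom.baseChange ℂ)) : IsStablyNondegenerate (C.prod A) :=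
  (hA.prod_cmCurve_of_traceNonres hC1 χ hd' hχ hNR).of_isIsogenous (isIsogenous_prod_swap C A)

end ConditionD

/-! ### §6 (NONRES) for `A = A₁ × A₂` with imaginary quadratic `End⁰(Aᵢ)` -/

section ProductData

variable {A₁ A₂ C : AbelianVariety ℂ}

universe u in
/-- Base change of a rational multiple: `(c • T)_ℂ = c • T_ℂ`. [folklore] -/
private theorem baseChange_ratCast_smul_ps {W : Type u} [AddCommGroup W] [Module ℚ W] (c : ℚ) (T : Module.End ℚ W) :
    (c • T).baseChange ℂ = (c : ℂ) • T.baseChange ℂ := by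
  refine TensorProduct.AlgebraTensorModule.ext fun z v => ?_
  rw [LinearMap.baseChange_tmul, LinearMap.smul_apply, LinearMap.smul_apply, LinearMap.baseChange_tmul,
    TensorProduct.smul_tmul', ← TensorProduct.smul_tmul, Rat.smul_def, smul_eq_mul]

/-- **`tr(Θ_A ∘ b_ℂ) = y · tr(Θ_A ∘ φ^*_ℂ)` for `b = x·1 + y·φ^*`** (`tr Θ_A = 0`). [cite: MoonenZarhin1999LowDim, §2 (2.3)]
[cite: Gordon1997, 1.13.2] -/
theorem trace_theta_mul_baseChange_smul_one_add_smul {A : AbelianVariety ℂ} (hHD : exists_isReal_hodgeModel)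
    (φ : A ⟶ A) (x y : ℚ) {Θ : Module.End ℂ (ℂ ⊗[ℚ] bettiCohomology A.X 1)}
    (hΘ : ∀ p, ∀ v ∈ (BettiUniverse.hodge hHD (AbelianVariety.isSmoothProjective_holds (A := A)) 1).piece p
      (((1 : ℕ) : ℤ) - p), Θ v = ((2 * p - ((1 : ℕ) : ℤ) : ℤ) : ℂ) • v) :
    LinearMap.trace ℂ _ (Θ * (x • (1 : Module.End ℚ (bettiCohomology A.X 1)) +
        y • (bettiCohomology.map φ.hom.hom.hom 1).hom).baseChange ℂ) =
      (y : ℂ) * LinearMap.trace ℂ _ (Θ * (bettiCohomology.map φ.hom.hom.hom 1).hom.baseChange ℂ) := by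
  haveI : HodgeTensorFacts.{0, 0} := hodgeTensorFacts_holds.{0, 0}
  haveI : Module.Finite ℚ (bettiCohomology A.X 1) := finite_bettiCohomology_one A
  have hX : IsSmoothProjective A.dim A.X := AbelianVariety.isSmoothProjective_holds
  have h0 : LinearMap.trace ℂ _ Θ = 0 :=
    trace_hodgeTheta_eq_zero_of_weight_one (BettiUniverse.hodge hHD hX 1) (Nat.cast_one)
      (BettiUniverse.hodge_isEffective hHD hX 1) hΘ
  have h1 : (1 : Module.End ℚ (bettiCohomology A.X 1)).baseChange ℂ = 1 := by
    rw [Module.End.one_eq_id, LinearMap.baseChange_id]; rfl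
  rw [LinearMap.baseChange_add, baseChange_ratCast_smul_ps, baseChange_ratCast_smul_ps, h1, mul_add, mul_smul_comm,
    mul_smul_comm, mul_one, map_add, map_smul, map_smul, h0, smul_zero, zero_add, smul_eq_mul]

/-- **(NONRES) for `A = A₁ × A₂` with imaginary quadratic endomorphism algebras.** Let `Aᵢ` (`dim Aᵢ > 0`) have
`dim_ℚ End⁰(Aᵢ) = 2` and `φᵢ ≫ φᵢ = -dᵢ` (`dᵢ > 0`), and let `E` be an elliptic curve with `χ ≫ χ = -d'` such that
`d' ≠ q²d₁` and `d' ≠ q²d₂` for every rational `q` («there does not exist an embedding of `End⁰(E)` into the center of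
`End⁰(Y)`», `Y = A₁ × A₂` with centre `⊆ ℚ(φ₁) × ℚ(φ₂)`). Then for every central Hodge endomorphism `b` of
`H¹(A₁ × A₂)`: `tr((χ^*)²)·tr(Θ_A b_ℂ) ≠ tr(Θ_E χ^*_ℂ)`. Proof: the corners `bᵢ = π_i b ι_i` are Hodge endomorphisms of
`H¹(Aᵢ)`, so `bᵢ = xᵢ + yᵢφᵢ^*` (Riemann, `exists_eq_smul_one_add_smul_bettiMapHom`) and
`tr(Θ_A b) = Σᵢ yᵢ·tr(Θᵢφᵢ^*) = Σᵢ yᵢ·2i√dᵢ(nᵢ - nᵢ')` (`trace_theta_mul_baseChange_eq_add_of_central`,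
`trace_theta_mul_baseChange_pullback_eq`); with `tr((χ^*)²) = -2d'` and `tr(Θ_E χ^*) = ±2i√d'` a resonance reads
`√d' ∈ ℚ√d₁ + ℚ√d₂` — §1. [cite: MoonenZarhin1999LowDim, §3 Prop. (3.8) and §5 (5.11)] [cite: Gordon1997, 1.13.2]
[cite: DeligneMilne1982Tannakian, §6 Thm. 6.20] -/
theorem traceNonres_prod_of_quadraticEnd (hA₁0 : 0 < A₁.dim) (hA₁2 : Module.finrank ℚ A₁.endAlgebra = 2)
    (φ₁ : A₁ ⟶ A₁) {d₁ : ℕ} (hd₁ : 0 < d₁) (hφ₁ : φ₁ ≫ φ₁ = -(d₁ • 𝟙 A₁))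
    (hA₂0 : 0 < A₂.dim) (hA₂2 : Module.finrank ℚ A₂.endAlgebra = 2)
    (φ₂ : A₂ ⟶ A₂) {d₂ : ℕ} (hd₂ : 0 < d₂) (hφ₂ : φ₂ ≫ φ₂ = -(d₂ • 𝟙 A₂))
    (hC1 : C.dim = 1) (χ : C ⟶ C) {d' : ℕ} (hd' : 0 < d') (hχ : χ ≫ χ = -(d' • 𝟙 C))
    (hfree₁ : ∀ q : ℚ, (d' : ℚ) ≠ q ^ 2 * d₁) (hfree₂ : ∀ q : ℚ, (d' : ℚ) ≠ q ^ 2 * d₂) :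
    ∀ {ΘA : Module.End ℂ (ℂ ⊗[ℚ] bettiCohomology (A₁.prod A₂).X 1)},
      (∀ p, ∀ x ∈ (BettiUniverse.hodge exists_isReal_hodgeModel_holds
        (AbelianVariety.isSmoothProjective_holds (A := A₁.prod A₂)) 1).piece p (((1 : ℕ) : ℤ) - p),
        ΘA x = ((2 * p - ((1 : ℕ) : ℤ) : ℤ) : ℂ) • x) →
      ∀ {ΘC : Module.End ℂ (ℂ ⊗[ℚ] bettiCohomology C.X 1)},
      (∀ p, ∀ x ∈ (BettiUniverse.hodge exists_isReal_hodgeModel_holds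
        (AbelianVariety.isSmoothProjective_holds (A := C)) 1).piece p (((1 : ℕ) : ℤ) - p),
        ΘC x = ((2 * p - ((1 : ℕ) : ℤ) : ℤ) : ℂ) • x) →
      ∀ b ∈ (BettiUniverse.hodge exists_isReal_hodgeModel_holds
        (AbelianVariety.isSmoothProjective_holds (A := A₁.prod A₂)) 1).endAlg,
      (∀ a ∈ (BettiUniverse.hodge exists_isReal_hodgeModel_holds
        (AbelianVariety.isSmoothProjective_holds (A := A₁.prod A₂)) 1).endAlg, b * a = a * b) →
      ((LinearMap.trace ℚ _ ((bettiCohomology.map χ.hom.hom.hom 1).hom *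
          (bettiCohomology.map χ.hom.hom.hom 1).hom) : ℚ) : ℂ) * LinearMap.trace ℂ _ (ΘA * b.baseChange ℂ) ≠
        LinearMap.trace ℂ _ (ΘC * (bettiCohomology.map χ.hom.hom.hom 1).hom.baseChange ℂ) := by
  intro ΘA hΘA ΘC hΘC b hb hbc heq
  -- the setting
  have hHD : exists_isReal_hodgeModel := exists_isReal_hodgeModel_holds
  have hI : hodgePQ_independent_of_hodgeModel := hodgePQ_independent_of_hodgeModel_holds
  haveI : HodgeTensorFacts.{0, 0} := hodgeTensorFacts_holds.{0, 0}
  have hX₁ : IsSmoothProjective A₁.dim A₁.X := AbelianVariety.isSmoothProjective_holds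
  have hX₂ : IsSmoothProjective A₂.dim A₂.X := AbelianVariety.isSmoothProjective_holds
  have hXP : IsSmoothProjective (A₁.prod A₂).dim (A₁.prod A₂).X := AbelianVariety.isSmoothProjective_holds
  haveI : Module.Finite ℚ (bettiCohomology A₁.X 1) := finite_bettiCohomology_one A₁
  haveI : Module.Finite ℚ (bettiCohomology A₂.X 1) := finite_bettiCohomology_one A₂
  haveI : Module.Finite ℚ (bettiCohomology (A₁.prod A₂).X 1) := finite_bettiCohomology_one (A₁.prod A₂)
  haveI : Module.Finite ℚ (bettiCohomology C.X 1) := finite_bettiCohomology_one C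
  -- the presentation `H¹(A₁ × A₂) = pr₁^* H¹(A₁) ⊕ pr₂^* H¹(A₂)` by morphisms of Hodge structures
  set ι₁ := BettiUniverse.pullHodgeHom hHD hI hXP hX₁ (Motives.AbelianVariety.fst A₁ A₂).hom.hom.hom 1 with hι₁
  set π₁ := BettiUniverse.pullHodgeHom hHD hI hX₁ hXP (HOneProduct.inlHom A₁ A₂).hom.hom.hom 1 with hπ₁
  set ι₂ := BettiUniverse.pullHodgeHom hHD hI hXP hX₂ (Motives.AbelianVariety.snd A₁ A₂).hom.hom.hom 1 with hι₂
  set π₂ := BettiUniverse.pullHodgeHom hHD hI hX₂ hXP (HOneProduct.inrHom A₁ A₂).hom.hom.hom 1 with hπ₂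
  have hπι₁ : π₁.toLinearMap ∘ₗ ι₁.toLinearMap = LinearMap.id := HOneProduct.pullInl_comp_pullFst
  have hπι₂ : π₂.toLinearMap ∘ₗ ι₂.toLinearMap = LinearMap.id := HOneProduct.pullInr_comp_pullSnd
  have hπ₁ι₂ : π₁.toLinearMap ∘ₗ ι₂.toLinearMap = 0 := HOneProduct.pullInl_comp_pullSnd
  have hπ₂ι₁ : π₂.toLinearMap ∘ₗ ι₁.toLinearMap = 0 := HOneProduct.pullInr_comp_pullFst
  have hsum : ι₁.toLinearMap ∘ₗ π₁.toLinearMap + ι₂.toLinearMap ∘ₗ π₂.toLinearMap = LinearMap.id :=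
    HOneProduct.pullFst_comp_pullInl_add
  -- the Hodge operators of the factors
  obtain ⟨Θ₁, hΘ₁⟩ := exists_hodgeTheta (BettiUniverse.hodge hHD hX₁ 1)
  obtain ⟨Θ₂, hΘ₂⟩ := exists_hodgeTheta (BettiUniverse.hodge hHD hX₂ 1)
  -- central corners and the additive trace
  obtain ⟨⟨hb₁E, -⟩, ⟨hb₂E, -⟩, htr⟩ := trace_theta_mul_baseChange_eq_add_of_central (BettiUniverse.hodge hHD hXP 1)
    (BettiUniverse.hodge hHD hX₁ 1) (BettiUniverse.hodge hHD hX₂ 1) ι₁ π₁ ι₂ π₂ hπι₁ hπι₂ hπ₁ι₂ hπ₂ι₁ hsum hΘA hΘ₁ hΘ₂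
    hb hbc
  -- the corners are `xᵢ + yᵢ φᵢ^*` (Riemann)
  obtain ⟨x₁, y₁, hb₁⟩ := exists_eq_smul_one_add_smul_bettiMapHom hHD hI hd₁ hφ₁ hA₁2 hA₁0 _ hb₁E
  obtain ⟨x₂, y₂, hb₂⟩ := exists_eq_smul_one_add_smul_bettiMapHom hHD hI hd₂ hφ₂ hA₂2 hA₂0 _ hb₂E
  rw [htr, hb₁, hb₂, trace_theta_mul_baseChange_smul_one_add_smul hHD φ₁ x₁ y₁ hΘ₁,
    trace_theta_mul_baseChange_smul_one_add_smul hHD φ₂ x₂ y₂ hΘ₂,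
    trace_theta_mul_baseChange_pullback_eq hHD hI φ₁ hd₁ hφ₁ hΘ₁,
    trace_theta_mul_baseChange_pullback_eq hHD hI φ₂ hd₂ hφ₂ hΘ₂,
    trace_theta_mul_baseChange_pullback_eq hHD hI χ hd' hχ hΘC, trace_pullback_mul_self_eq χ hχ, hC1] at heq
  -- the multiplicities of `χ` on `H^{1,0}(E)` are `(1,0)` or `(0,1)`
  have hsumC := eigenMultiplicity_add_eigenMultiplicity_neg_eq_dim C χ hd' hχ
  rw [hC1] at hsumC
  set n₁ := eigenMultiplicity A₁ φ₁ (Complex.I * (Real.sqrt d₁ : ℂ)) with hn₁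
  set n₁' := eigenMultiplicity A₁ φ₁ (-(Complex.I * (Real.sqrt d₁ : ℂ))) with hn₁'
  set n₂ := eigenMultiplicity A₂ φ₂ (Complex.I * (Real.sqrt d₂ : ℂ)) with hn₂
  set n₂' := eigenMultiplicity A₂ φ₂ (-(Complex.I * (Real.sqrt d₂ : ℂ))) with hn₂'
  set a' := eigenMultiplicity C χ (Complex.I * (Real.sqrt d' : ℂ)) with ha'
  set b' := eigenMultiplicity C χ (-(Complex.I * (Real.sqrt d' : ℂ))) with hb'
  -- the real identity: cancel `I`
  have hreal : (-((d' : ℝ) * 2) * ((y₁ : ℝ) * (2 * Real.sqrt d₁ * ((n₁ : ℝ) - (n₁' : ℝ))) +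
      (y₂ : ℝ) * (2 * Real.sqrt d₂ * ((n₂ : ℝ) - (n₂' : ℝ)))) : ℝ) = 2 * Real.sqrt d' * ((a' : ℝ) - (b' : ℝ)) := by
    have h1 : Complex.I * ((-((d' : ℝ) * 2) * ((y₁ : ℝ) * (2 * Real.sqrt d₁ * ((n₁ : ℝ) - (n₁' : ℝ))) +
        (y₂ : ℝ) * (2 * Real.sqrt d₂ * ((n₂ : ℝ) - (n₂' : ℝ)))) : ℝ) : ℂ) =
        Complex.I * ((2 * Real.sqrt d' * ((a' : ℝ) - (b' : ℝ)) : ℝ) : ℂ) := by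
      push_cast
      push_cast at heq
      linear_combination heq
    exact_mod_cast mul_left_cancel₀ Complex.I_ne_zero h1
  -- `a' - b' = ±1`
  rcases Nat.eq_zero_or_pos a' with h0 | h0
  · have h1 : b' = 1 := by omega
    rw [h0, h1] at hreal
    apply sqrt_ne_ratCast_mul_sqrt_add_of_forall_ne hd₁ hd₂ hfree₁ hfree₂
      (d' * 2 * (y₁ * ((n₁ : ℚ) - n₁'))) (d' * 2 * (y₂ * ((n₂ : ℚ) - n₂')))
    push_cast
    push_cast at hreal
    linear_combination (1 / 2 : ℝ) * hreal
  · have h1 : a' = 1 := by omega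
    have h2 : b' = 0 := by omega
    rw [h1, h2] at hreal
    apply sqrt_ne_ratCast_mul_sqrt_add_of_forall_ne hd₁ hd₂ hfree₁ hfree₂
      (-(d' * 2 * (y₁ * ((n₁ : ℚ) - n₁')))) (-(d' * 2 * (y₂ * ((n₂ : ℚ) - n₂'))))
    push_cast
    push_cast at hreal
    linear_combination (-1 / 2 : ℝ) * hreal

/-- **`E × (A₁ × A₂)` is stably nondegenerate** when `A₁ × A₂` is, `dim_ℚ End⁰(Aᵢ) = 2` with `φᵢ ≫ φᵢ = -dᵢ`, and `E` is
an elliptic curve with `χ ≫ χ = -d'`, `d' ≠ q²dᵢ` («no embedding of `End⁰(E)` into the center of `End⁰(Y)`»,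
Prop. (3.8) ⟹ `Hg(E × Y) = Hg(E) × Hg(Y)`, hence (D) by Thm. (3.2)). [cite: MoonenZarhin1999LowDim, §3 Thm. (3.2), Prop. (3.8) and §5 (5.11)]
[cite: Gordon1999HodgeAVSurvey, Def. 7.6] -/
theorem IsStablyNondegenerate.cmCurve_prod_prod_of_quadraticEnd (hA : IsStablyNondegenerate (A₁.prod A₂))
    (hA₁0 : 0 < A₁.dim) (hA₁2 : Module.finrank ℚ A₁.endAlgebra = 2)
    (φ₁ : A₁ ⟶ A₁) {d₁ : ℕ} (hd₁ : 0 < d₁) (hφ₁ : φ₁ ≫ φ₁ = -(d₁ • 𝟙 A₁))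
    (hA₂0 : 0 < A₂.dim) (hA₂2 : Module.finrank ℚ A₂.endAlgebra = 2)
    (φ₂ : A₂ ⟶ A₂) {d₂ : ℕ} (hd₂ : 0 < d₂) (hφ₂ : φ₂ ≫ φ₂ = -(d₂ • 𝟙 A₂))
    (hC1 : C.dim = 1) (χ : C ⟶ C) {d' : ℕ} (hd' : 0 < d') (hχ : χ ≫ χ = -(d' • 𝟙 C))
    (hfree₁ : ∀ q : ℚ, (d' : ℚ) ≠ q ^ 2 * d₁) (hfree₂ : ∀ q : ℚ, (d' : ℚ) ≠ q ^ 2 * d₂) :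
    IsStablyNondegenerate (C.prod (A₁.prod A₂)) :=
  hA.cmCurve_prod_of_traceNonres hC1 χ hd' hχ
    (traceNonres_prod_of_quadraticEnd hA₁0 hA₁2 φ₁ hd₁ hφ₁ hA₂0 hA₂2 φ₂ hd₂ hφ₂ hC1 χ hd' hχ hfree₁ hfree₂)

end ProductData

/-! ### §7 The row (5.11): `E_k × E_{k'} × T` -/

section RowEET

variable {E₁ E₂ T : AbelianVariety ℂ}

/-- Two non-isogenous elliptic curves of CM type with `χᵢ ≫ χᵢ = -dᵢ` have `d₁ ≠ q²d₂` for every rational `q`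
(«`End⁰(E) = End⁰(Y₁)` implies that `E ∼ Y₁`»: same CM field ⟹ Hodge-isogenous (the tree's
`EllipticCurve.hodgeIsogenous_of_cm_of_isSquare`) ⟹ isogenous (Riemann, `deligneMilne1982_Thm_6_20_full_holds`)).
[cite: MoonenZarhin1999LowDim, §5 (5.11) and §3 Lemma (3.3)] [cite: DeligneMilne1982Tannakian, §6 Thm. 6.20] -/
theorem forall_ne_sq_mul_of_not_isIsogenous_curves (hE₁ : E₁.dim = 1) (hE₂ : E₂.dim = 1)
    (hni : ¬ AbelianVariety.IsIsogenous E₁ E₂) {χ₁ : E₁ ⟶ E₁} {χ₂ : E₂ ⟶ E₂} {d₁ d₂ : ℕ} (hd₁ : 0 < d₁)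
    (hd₂ : 0 < d₂) (hχ₁ : χ₁ ≫ χ₁ = -(d₁ • 𝟙 E₁)) (hχ₂ : χ₂ ≫ χ₂ = -(d₂ • 𝟙 E₂)) :
    ∀ q : ℚ, (d₁ : ℚ) ≠ q ^ 2 * d₂ := by
  refine forall_ne_sq_mul_of_not_isSquare (EllipticCurve.not_isSquare_of_not_hodgeIsogenous hE₁ hE₂ χ₁ χ₂ hd₁ hd₂
    hχ₁ hχ₂ fun h => hni ?_)
  exact (EllipticCurve.hodgeIsogenous_iff_isIsogenous deligneMilne1982_Thm_6_20_full_holds hE₁ hE₂).1 h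

/-- **THE ROW (5.11) (Moonen–Zarhin Thm. 0.2 (4) for `E_k × E_{k'} × T`, `T` simple of type IV(1,1)): for elliptic
curves `E₁, E₂` OF CM TYPE, NOT ISOGENOUS, and a SIMPLE abelian threefold `T` with `dim_ℚ End⁰(T) = 2` (so
`End⁰(T) = k''` imaginary quadratic, `T` NOT of CM type) admitting NO ring homomorphism `End⁰(Eᵢ) → End⁰(T)`
(`kᵢ ≇ k''`: outside cases (e)/(f)), `E₁ × (E₂ × T)` is stably nondegenerate** — `B•(Xⁿ) = D•(Xⁿ)` for all `n`.
`E₂ × T` is (D) by the tree's R24 row; then Prop. (3.8) for `Y = E₂ × T`, whose centre `k' × k''` admits no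
embedding of `k` (`k ≇ k'` since `E₁ ≁ E₂`, `k ≇ k''`). [cite: MoonenZarhin1999LowDim, Thm. 0.2 (4), §3 Prop. (3.8) and §5 (5.11)]
[cite: Gordon1999HodgeAVSurvey, Def. 7.6] -/
theorem isStablyNondegenerate_cmCurve_prod_cmCurve_prod_of_isSimple_threefold_of_finrank_eq_two (hE₁ : E₁.dim = 1)
    (hE₂ : E₂.dim = 1) (h₁ : IsOfCMType E₁) (h₂ : IsOfCMType E₂) (hni : ¬ AbelianVariety.IsIsogenous E₁ E₂)
    (hT : T.IsSimple) (hT3 : T.dim = 3) (hT2 : Module.finrank ℚ T.endAlgebra = 2)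
    (i₁ : IsEmpty (E₁.endAlgebra →+* T.endAlgebra)) (i₂ : IsEmpty (E₂.endAlgebra →+* T.endAlgebra)) :
    IsStablyNondegenerate (E₁.prod (E₂.prod T)) := by
  obtain ⟨χ₁, d₁, hd₁, hχ₁⟩ := exists_hom_comp_self_eq_neg_of_cmCurve hE₁ h₁
  obtain ⟨χ₂, d₂, hd₂, hχ₂⟩ := exists_hom_comp_self_eq_neg_of_cmCurve hE₂ h₂
  obtain ⟨φ, d, hd, hφ⟩ := exists_hom_comp_self_eq_neg_of_isSimple_threefold_of_finrank_eq_two hT hT3 hT2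
  have hD : IsStablyNondegenerate (E₂.prod T) :=
    isStablyNondegenerate_cmCurve_prod_of_isSimple_threefold_of_finrank_eq_two_of_isEmpty hE₂ h₂ hT hT3 hT2 i₂
  have hfree₂ : ∀ q : ℚ, (d₁ : ℚ) ≠ q ^ 2 * d₂ :=
    forall_ne_sq_mul_of_not_isIsogenous_curves hE₁ hE₂ hni hd₁ hd₂ hχ₁ hχ₂
  have hfreeT : ∀ q : ℚ, (d₁ : ℚ) ≠ q ^ 2 * d := forall_ne_sq_mul_symm hd₁
    (forall_ne_sq_mul_of_isEmpty_ringHom i₁ (finrank_endAlgebra_eq_two_of_cmCurve hE₁ h₁) hd₁ hχ₁ hφ hd)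
  exact hD.cmCurve_prod_prod_of_quadraticEnd (by omega) (finrank_endAlgebra_eq_two_of_cmCurve hE₂ h₂) χ₂ hd₂ hχ₂
    (by omega) hT2 φ hd hφ hE₁ χ₁ hd₁ hχ₁ hfree₂ hfreeT

/-- **The same row in the spelling «`T` of type IV and NOT of CM type»** (`¬ HasNoTypeIVFactor T ∧ ¬ IsOfCMType T`):
for a simple threefold `dim_ℚ End⁰(T) ∈ {1, 2, 3, 6}`; `1` and `3` have no factor of type IV, `6` is CM type, so
`dim_ℚ End⁰(T) = 2`. This is EXACTLY the displayed hypothesis `hEET` of the cell's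
`Summit.HodgeConjecture.Ring2.NonSimpleFivefolds.isStablyNondegenerate_of_dim_eq_five_of_not_isSimple_of`.
[cite: MoonenZarhin1999LowDim, Thm. 0.2 (4), §2 (2.3) and §5 (5.11)] [cite: MumfordAV1970, §21] -/
theorem isStablyNondegenerate_cmCurve_prod_cmCurve_prod_threefold_of_typeIV_of_not_isOfCMType (hE₁ : E₁.dim = 1)
    (hE₂ : E₂.dim = 1) (h₁ : IsOfCMType E₁) (h₂ : IsOfCMType E₂) (hni : ¬ AbelianVariety.IsIsogenous E₁ E₂)
    (hT3 : T.dim = 3) (hT : T.IsSimple) (hTcm : ¬ IsOfCMType T) (hT4 : ¬ HasNoTypeIVFactor T)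
    (i₁ : IsEmpty (E₁.endAlgebra →+* T.endAlgebra)) (i₂ : IsEmpty (E₂.endAlgebra →+* T.endAlgebra)) :
    IsStablyNondegenerate (E₁.prod (E₂.prod T)) := by
  rcases AbelianVariety.finrank_endAlgebra_mem_of_isSimple_threefold hT hT3 with h1 | h2 | h3 | h6
  · exact absurd (hasNoTypeIVFactor_of_finrank_endAlgebra_eq_one h1) hT4
  · exact isStablyNondegenerate_cmCurve_prod_cmCurve_prod_of_isSimple_threefold_of_finrank_eq_two hE₁ hE₂ h₁ h₂ hni hT
      hT3 h2 i₁ i₂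
  · exact absurd (hasNoTypeIVFactor_of_isSimple_threefold_of_finrank_eq_three hT hT3 h3) hT4
  · exact absurd (isOfCMType_of_isSimple_threefold_of_finrank_eq_six hT hT3 h6) hTcm

/-- `B = D` on every power `(E₁ × E₂ × T)^{N+1}`. [cite: MoonenZarhin1999LowDim, Thm. 0.2 (4) and §5 (5.11)] -/
theorem isDivisorGenerated_powSucc_cmCurve_prod_cmCurve_prod_threefold_of_typeIV_of_not_isOfCMType (hE₁ : E₁.dim = 1)
    (hE₂ : E₂.dim = 1) (h₁ : IsOfCMType E₁) (h₂ : IsOfCMType E₂) (hni : ¬ AbelianVariety.IsIsogenous E₁ E₂)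
    (hT3 : T.dim = 3) (hT : T.IsSimple) (hTcm : ¬ IsOfCMType T) (hT4 : ¬ HasNoTypeIVFactor T)
    (i₁ : IsEmpty (E₁.endAlgebra →+* T.endAlgebra)) (i₂ : IsEmpty (E₂.endAlgebra →+* T.endAlgebra)) (N : ℕ) :
    IsDivisorGenerated ((E₁.prod (E₂.prod T)).powSucc N) :=
  isStablyNondegenerate_cmCurve_prod_cmCurve_prod_threefold_of_typeIV_of_not_isOfCMType hE₁ hE₂ h₁ h₂ hni hT3 hT hTcm
    hT4 i₁ i₂ N

/-- **The Hodge conjecture for every power `(E₁ × E₂ × T)^{N+1}`** of the row (5.11) — UNCONDITIONALLY (no HC_CM).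
[cite: MoonenZarhin1999LowDim, Thm. 0.2 (4) and §5 (5.11)] [cite: vanGeemen1994HodgeAV, §2.4 and Lemma 3.7] -/
theorem hodgeConjectureFor_powSucc_cmCurve_prod_cmCurve_prod_threefold_of_typeIV_of_not_isOfCMType (hE₁ : E₁.dim = 1)
    (hE₂ : E₂.dim = 1) (h₁ : IsOfCMType E₁) (h₂ : IsOfCMType E₂) (hni : ¬ AbelianVariety.IsIsogenous E₁ E₂)
    (hT3 : T.dim = 3) (hT : T.IsSimple) (hTcm : ¬ IsOfCMType T) (hT4 : ¬ HasNoTypeIVFactor T)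
    (i₁ : IsEmpty (E₁.endAlgebra →+* T.endAlgebra)) (i₂ : IsEmpty (E₂.endAlgebra →+* T.endAlgebra)) (N : ℕ) :
    HodgeConjectureFor ((E₁.prod (E₂.prod T)).powSucc N).dim ((E₁.prod (E₂.prod T)).powSucc N).X :=
  (isStablyNondegenerate_cmCurve_prod_cmCurve_prod_threefold_of_typeIV_of_not_isOfCMType hE₁ hE₂ h₁ h₂ hni hT3 hT hTcm
    hT4 i₁ i₂).hodgeConjectureFor_powSucc N

/-- **The Hodge conjecture for the abelian FIVEFOLD `E₁ × E₂ × T` of the row (5.11) itself.**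
[cite: MoonenZarhin1999LowDim, Thm. 0.2 (4) and §5 (5.11)] -/
theorem hodgeConjectureFor_cmCurve_prod_cmCurve_prod_threefold_of_typeIV_of_not_isOfCMType (hE₁ : E₁.dim = 1)
    (hE₂ : E₂.dim = 1) (h₁ : IsOfCMType E₁) (h₂ : IsOfCMType E₂) (hni : ¬ AbelianVariety.IsIsogenous E₁ E₂)
    (hT3 : T.dim = 3) (hT : T.IsSimple) (hTcm : ¬ IsOfCMType T) (hT4 : ¬ HasNoTypeIVFactor T)
    (i₁ : IsEmpty (E₁.endAlgebra →+* T.endAlgebra)) (i₂ : IsEmpty (E₂.endAlgebra →+* T.endAlgebra)) :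
    HodgeConjectureFor (E₁.prod (E₂.prod T)).dim (E₁.prod (E₂.prod T)).X :=
  (isStablyNondegenerate_cmCurve_prod_cmCurve_prod_threefold_of_typeIV_of_not_isOfCMType hE₁ hE₂ h₁ h₂ hni hT3 hT hTcm
    hT4 i₁ i₂).hodgeConjectureFor

/-- **Everything isogenous to `E₁ × E₂ × T`** (van Geemen Lemma 3.7) is stably nondegenerate.
[cite: MoonenZarhin1999LowDim, Thm. 0.2 (4) and §5 (5.11)] [cite: vanGeemen1994HodgeAV, Lemma 3.7 and §3.6] -/
theorem isStablyNondegenerate_of_isIsogenous_cmCurve_prod_cmCurve_prod_threefold_of_typeIV_of_not_isOfCMType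
    (hE₁ : E₁.dim = 1) (hE₂ : E₂.dim = 1) (h₁ : IsOfCMType E₁) (h₂ : IsOfCMType E₂)
    (hni : ¬ AbelianVariety.IsIsogenous E₁ E₂) (hT3 : T.dim = 3) (hT : T.IsSimple) (hTcm : ¬ IsOfCMType T)
    (hT4 : ¬ HasNoTypeIVFactor T) (i₁ : IsEmpty (E₁.endAlgebra →+* T.endAlgebra))
    (i₂ : IsEmpty (E₂.endAlgebra →+* T.endAlgebra)) {X : AbelianVariety ℂ}
    (hX : AbelianVariety.IsIsogenous X (E₁.prod (E₂.prod T))) : IsStablyNondegenerate X :=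
  (isStablyNondegenerate_cmCurve_prod_cmCurve_prod_threefold_of_typeIV_of_not_isOfCMType hE₁ hE₂ h₁ h₂ hni hT3 hT hTcm
    hT4 i₁ i₂).of_isIsogenous hX

/-- The Hodge conjecture for everything isogenous to a power of `E₁ × E₂ × T`. [cite: MoonenZarhin1999LowDim, Thm. 0.2 (4) and §5 (5.11)]
[cite: vanGeemen1994HodgeAV, Lemma 3.7] -/
theorem hodgeConjectureFor_of_isIsogenous_powSucc_cmCurve_prod_cmCurve_prod_threefold_of_typeIV_of_not_isOfCMType
    (hE₁ : E₁.dim = 1) (hE₂ : E₂.dim = 1) (h₁ : IsOfCMType E₁) (h₂ : IsOfCMType E₂)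
    (hni : ¬ AbelianVariety.IsIsogenous E₁ E₂) (hT3 : T.dim = 3) (hT : T.IsSimple) (hTcm : ¬ IsOfCMType T)
    (hT4 : ¬ HasNoTypeIVFactor T) (i₁ : IsEmpty (E₁.endAlgebra →+* T.endAlgebra))
    (i₂ : IsEmpty (E₂.endAlgebra →+* T.endAlgebra)) {X : AbelianVariety ℂ} {N : ℕ}
    (hX : AbelianVariety.IsIsogenous X ((E₁.prod (E₂.prod T)).powSucc N)) : HodgeConjectureFor X.dim X.X :=
  (isStablyNondegenerate_cmCurve_prod_cmCurve_prod_threefold_of_typeIV_of_not_isOfCMType hE₁ hE₂ h₁ h₂ hni hT3 hT hTcm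
    hT4 i₁ i₂).hodgeConjectureFor_of_isIsogenous_powSucc hX

/- **On path**: the Hodge conjecture gives every target of this file — the tree's
`hodgeConjectureFor_prod_of_hodgeConjecture'` (`ThetaTraceTimesCMProductSpan`), not re-declared (gate dedup). -/
example (h : ∀ ⦃n : ℕ⦄ ⦃X : Motives.SchemeOver ℂ⦄, Motives.IsSmoothProjective n X → HodgeConjectureFor n X)
    (E₁ E₂ T : AbelianVariety ℂ) : HodgeConjectureFor (E₁.prod (E₂.prod T)).dim (E₁.prod (E₂.prod T)).X :=
  hodgeConjectureFor_prod_of_hodgeConjecture' h E₁ (E₂.prod T)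

end RowEET

end Literature.AlgebraicGeometry.HodgeTheory

end
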